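import Mathlib
import HarnessLib
import HarnessLib.Audit
import Summits.AtomisticToContinuum.Statement
import Literature.MathematicalPhysics.KineticTheory.TwoTemperatureEuler
import Literature.Analysis.FluidPDE.LoadedSphereDynamics
import Literature.MathematicalPhysics.KineticTheory.LoadedExchangeRate
import HarnessLib.Audit.Status.Attr

/-!
Route: JeansLoadedDice

DORMANT since 2026-08-26T14:59:12Z (reconciler: no traction for 6.7 d (last activity item-proof-filed at 2026-08-19T22:27:22Z); parked, not closed — `ledger route dormant route-AtomisticToContinuum-JeansLoadedDice --off` to reactivate) — unstaffed, not closed; items shared with open routes are served there. `ledger route dormant <id> --off` reactivates.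

# Route JeansLoadedDice — Loaded dice — Jeans' eccentric spheres read an integrable clock at each
contact — an Euler rung with the exact hard-sphere law for a Hamiltonian gas, and a
one-kick-footprint transfer to the conjunct

X = X_R ∧ X_T ("it suffices to show"), realising card loaded-dice-jeans-spheres (spine and only
card). THE FAMILY LS(σ, ξ, ι): N+1 of Jeans' LOADED SPHERES on 𝕋³ — perfectly smooth hard spheres of
diameter ε_N = σ(N+1)^(-1/3) (the conjunct's own scaling: fixed reduced density) and unit mass whose
mass centre sits ξε_N off the geometric centre along a body vector a ∈ S², with isotropic inertia
ιε_N² about the mass centre; deterministic dynamics = free flight of the mass centre and uniform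
rotation of a about the angular momentum L between contacts, and at a contact of geometric centres
the frictionless elastic rigid-body impact of support LoadedImpactInvolution (impulse J·n along the
contact normal, J = 2g_n/(2 + (ξ²/ι)Σ_k(1 − ⟨a_k,n⟩²)), g_n the normal velocity of the material
contact points); data = loaded local Gibbs (geometric centres hs-local-Gibbs with activity a₀,
Maxwellian(u₀,θ₀) velocities, Haar orientations, Gaussian angular momenta). ξ = 0 IS the conjunct's
gas (⊗ an invisible free rotation); EVERY member has exactly the hard-sphere statics (contact iff
geometric centres at distance ε_N: hsFreeVolume, hsPressure unchanged) and conserves mass, momentum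
and energy; L·a is conserved per particle (passive label), so two rotational degrees of freedom are
active.
X_R (LOADED RUNG; cruxes PhaseFreshness rank 2 and LoadedEulerRung rank 4, both typed over the
landed definition requests D1–D2): for every FIXED ξ ∈ (0,1/2), ι > 0 and all continuous profiles
there is σ₀ such that for σ < σ₀ the empirical density / momentum / translational-kinetic-energy
fields of LS(σ,ξ,ι) converge in probability, up to the first shock and as long as the solution stays
a dilute fluid (local packing ρσ³ < η₀, the conjunct's own guard since its 2026-08-16 re-type D-0032
/ p126922), to the classical solution of the LOADED Euler system (p = hsPressure σ ρ θ, E = ρ(|u|²/2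
+ 5θ/2)) — a compressible-Euler theorem for a deterministic, reversible, momentum-conserving
Hamiltonian gas at fixed positive density with the conjunct's equation of state. Its engine is the
card's self-sustaining dice, typed as PhaseFreshness (rank 2, repaired 2026-08-16): at contacts,
conditionally on the r-coarse PRESENT of all particles and on the exact contact normal and
pre-contact pair data (V_i,V_j,L_i,L_j), the LONGITUDES of the two load phases about their angular
momenta are fresh — uniform up to the flux weight (approachSpeed)₊ — with defect η = C(φ/ξ + ε√ι/r +
r/ℓ) in the Campbell/L¹ sense (φ = ρσ³; at global equilibrium the identity is exact), because
between contacts a turns Θ ≈ 0.225/(φ√ι) ≫ 2π radians over a flight whose duration is uncertain by ≫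
one clock period given the coarse present, and each impact changes the clock RATE |L|/(ιε²) by a
relative O(ξ/√ι) (Fejér wrapping, support FejerWrapping); the latitudes are frozen labels (L·a
conserved) that ride along as passive marks, and chattering re-contacts of a pair (an O(ξ²/ι)
fraction of all impacts) are booked with their parent impact — no exceptional class.
X_T (TRANSFER; typed skeleton): OneKickFootprint (rank 3: the Euler-scale linear response of the
TRUE hard-sphere gas to one local momentum- and energy-conserving kick is hydrodynamic, O(ε_N/N) on
smooth fields) ∧ ContactIntensityDominationOneRare (rank 6: the ONE-RARE-PARTICIPANT
contact-intensity ceiling — the repaired ContactIntensityDomination, see the REPAIR NOTE below) ⇒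
HydrodynamicLimit through the consumer LoadedTransfer, whose intended proof is the loaded programme
run along ξ_N = κ(N+1)^(-1/6) (crux SlackRung, rank 5 — the repaired TwoTemperatureRung of the
2026-08-16T05Z repair: for every ι > 0 there is η₀ such that for σ < σ₀(ι, profiles), every
classical hs-Euler solution obeying the conjunct's packing guard ρσ³ < η₀ on [0,T), every t, χ and δ
there is κ₀ such that for κ < κ₀ the χ-tested translational fields of the loaded gas along ξ_N at
time t are within δ of the CONJUNCT's Euler solution with probability → 1 as N → ∞; κ → 0 is taken
inside the item, N₀ may depend on κ, and no macroscopic exchange-rate function is pinned — at fixed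
σ the translation–rotation exchange is the collisional force spectrum at the precession frequency,
R(Θ)·Enskog < Enskog and not closed in two temperatures (crux-attack on stmt-14496), but it enters
the translational budgets only at O(κ²); conjunct-hard and labelled so, and not a restatement: ξ_N >
0 at every N) plus a Lindeberg swap in ξ at the same N (the restated frame item Assembly :=
OneKickFootprint → SlackRung → ContactIntensityDominationOneRare → HydrodynamicLimit): the
≍(N+1)^(4/3) collisions contribute ξ_N × (footprint (N+1)^(-4/3)) each, O(ξ_N) in total at first
order and ξ_N²(N+1)^(1/3) = κ² at second order (translation–rotation energy exchange), then κ → 0.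
RE-FILING NOTE: this is the conforming re-filing of route LoadedDice (opened 2026-08-15T12:14Z,
closed `not-a-thesis` by the D-0027 §2.1 backfill at 13:44Z only because its Assembly named the
alias `Literature.MathematicalPhysics.KineticTheory.HydrodynamicLimit` instead of the sub-problem
Statement decl `_root_.HydrodynamicLimit`, to which it is definitionally equal); same items (the
typed ones were refuter-CHECKED there: OneKickFootprint 'survives as open-problem', FejerWrapping
'true with room'), deciding theorem `closes : OneKickFootprint → ContactIntensityDomination →
LoadedTransfer → _root_.HydrodynamicLimit` supplied in glue.lean.
RE-TYPE NOTE (2026-08-16T23Z, route-repair after p126922): the sub-problem Statement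
`_root_.HydrodynamicLimit` is now the PACKING-GUARDED def (∃η₀ outermost; verbatim
HydroLimitInBandDim 3); LoadedTransfer and Assembly name it and re-target it unchanged, `closes` is
the same modus ponens (re-certified rev 11), and the two hydrodynamic-limit-shaped rungs SlackRung
(rev 11) and LoadedEulerRung (rev 12) carry the same guard, the old η₀-free texts implying the new
ones.
REPAIR NOTE (2026-08-17T01Z, route-repair): the mark-uniform TWO-COPY contact budget
ContactIntensityDomination (stmt-9218, shared with SpeedCapSurgery / the retired
AprioriTailsRattlers) was REFUTED-MISSTATED by
Theorems.not_SpeedCapSurgery_ContactIntensityDomination (EnergyCurrentTails line lead, seat c4: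
hot-spot witness θ₀ x = 2 − ‖x‖, marks with TWO rare participants at ±Ve₁, window (0,h], h → 0, V →
∞ — a mixture over x of products M_θ(x)⊗M_θ(x) is not dominated by C × the product of the spatially
averaged marginals in the joint tail); it is replaced here by the refuter's repaired C′, variant (γ)
of Cruxes/EnergyCurrentTails/Lines/level_census_comparison_local_ceiling.lean taken VERBATIM —
ContactIntensityDominationOneRare (stmt-16939): the same Enskog ceiling restricted to
one-rare-participant marks ψ(v)(1+‖w‖)^k, k ≤ 3, uniform in continuous ψ, which passes the
inhomogeneous statics (rung ½) by construction and is exactly the shape the Lindeberg kick budget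
consumes (|g| ≤ ‖v−w‖ ≤ (1+‖v‖)(1+‖w‖)); LoadedTransfer (stmt-16943) and Assembly (stmt-16942) were
restated over it (their old texts had become vacuously true) and `closes` re-glued with the same
modus ponens (rev 16, glue certified native); the refuted record stays in the file as negative
knowledge.
Lean: `OneKickFootprint ∧ ContactIntensityDominationOneRare ∧ LoadedTransfer`

## Assembly
Pure logic (modus ponens; proved sorry-free as `assembly_holds` in the folder's Sketch.lean, axioms
propext / Classical.choice / Quot.sound): OneKickFootprint and ContactIntensityDominationOneRare are
fed to the consumer LoadedTransfer, whose conclusion is the sub-problem Statement decl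
`_root_.HydrodynamicLimit` itself (the deciding theorem `closes` of glue.lean is literally this
modus ponens). The CONTENT sits upstream (every item typed over D1–D2′ since the 2026-08-16
repairs): PhaseFreshness → LoadedEulerRung (the analogue rung X_R at fixed ξ, a parallel chain that
is NOT a hypothesis of the conjunct's assembly — it is where the dice engine is first provable and
MD-falsifiable) and SlackRung + the Lindeberg swap ⇒ LoadedTransfer, the swap being the frame item
Assembly := OneKickFootprint → SlackRung → ContactIntensityDominationOneRare → HydrodynamicLimit, so
that LoadedTransfer = Assembly ∘ SlackRung. Stated plainly: nothing below LoadedTransfer implies the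
conjunct without SlackRung, which is conjunct-hard.

Rationale: WHY THIS LINE. Jeans' loaded sphere (ChapmanCowling1970 §11.1 p. 200 and note (27): "a smooth
elastic sphere whose mass-centre does not coincide with its geometrical centre"; Jeans 1901/1904
studied exactly the equipartition of translatory and rotatory energy for slightly eccentric spheres;
kinetic/Enskog theory with chaos ASSUMED: Dahler–Sather doi:10.1063/1.1733511, Sandler–Dahler
doi:10.1063/1.1697003, doi:10.1063/1.1841253) is the minimal PHYSICAL Hamiltonian deformation of the
conjunct's system in which each collision consults a fast INTEGRABLE internal clock, and the card's
point is that the clock needs no chaos: fast-phase averaging (Arnold1989 §52; Kifer2009,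
Dolgopyat2005 for averaging with feedback) read at random contact times gives Fejér equidistribution
of the load LONGITUDES at contacts — flux-weighted, given the coarse present of all particles and
the exact pair data — with an EXPLICIT, N-INDEPENDENT defect C(φ/ξ + ε√ι/r + r/ℓ) at coarse-graining
scale r, regenerated flight after flight because every flight lasts an uncertain ≫ 1 number of clock
periods and the impact re-randomises the clock rate (random compositions of strongly kicked twist
maps: Blumenthal–Xue–Young doi:10.4007/annals.2017.185.1.5, doi:10.1007/s00220-017-2999-2) — so the
angular half of the Stosszahlansatz becomes a one-line mechanism on a gas with exactly the
conjunct's equation of state, and the stochastic-rung ergodic theorems (OllaVaradhanYau1993,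
FritzFunakiLebowitz1994, LiveraniOlla1996, Rezakhanlou2003) are asked only of the phase-AVERAGED
kernel. Imported areas: rigid-body impact mechanics (CoxFeres2016), averaging / random dynamical
systems (kicked tops), Yau's relative-entropy method, and the vanishing-load family ξ_N =
κ(N+1)^(-1/6) interpolating to the conjunct, along which the rotational coupling enters the
translational budgets only at O(κ²) (its two-temperature Euler description with the Enskog exchange
rate — hyperbolic relaxation à la ChenLevermoreLiu1994 — is only the σ → 0 asymptotic: at fixed σ
the exchange rate is the collisional force spectrum at the precession frequency, the
Landau–Teller/Zwanzig mechanism doi:10.1063/1.1731795, as the crux-attack on TwoTemperatureRung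
showed; the repaired rung SlackRung therefore targets the conjunct's Euler solution directly). What
it does that the board does not: AnosovRotorDice needs an ANOSOV rotor and a designed die,
VanishingNoise / SpecularLambertianSwap impose stochastic rules, SoftShoulderLandauDial changes the
equation of state along its dial — here the randomiser is integrable, the impact law physical, the
statics the conjunct's at every ξ; and the transfer analysis isolates a NEW typed true-gas
statement, OneKickFootprint (hydrodynamic size of the mean response to one conservative kick), which
is the load-bearing true-gas input of every kick-by-kick comparison on the board (VanishingNoise
(ii) stmt-0812, SpecularLambertianSwap.SwapGap, this route's LoadedTransfer) and fails for the ideal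
gas, as a genuine input must.

RANKED CRUXES. Five ranked cruxes, all typed (the vocabulary — D1 loaded flow, D2 loaded /
two-temperature Euler, D2′ loadedEccentricity / loadedExchangeRate — landed 2026-08-15;
PhaseFreshness and the rank-5 rung were repaired on 2026-08-16 after crux-attacks, as recorded
below):
Rank 2, PhaseFreshness (typed; repaired 2026-08-16 after the crux-attack verdict refuted-misstated,
evidence PhaseFreshness-cruxattack.md + REPAIR.md) — CONDITIONAL LONGITUDE FRESHNESS AT CONTACTS,
flux-weighted Campbell form: in LS(σ,ξ,ι), ξ ∈ (0,1/2), ι > 0, profiles and T fixed, ∃C ∃σ₀ ∀σ<σ₀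
∀κ≥1 (coarse scale r = κε_N) ∀ loaded flows ∃N₀ ∀N≥N₀: for every measurable weight G ∈ [0,1] of
(⌊τ/r⌋, the r-cells of the pre-contact positions and mass-centre velocities of ALL particles, the
pair (i,j), the exact normal n and pre-contact pair data p⁻ = (V_i,V_j,L_i,L_j), the phases a_i,
a_j), |E Σ_c G_c − E Σ_c ν_c[G_c]| ≤ η·E#{c} over all ordered contacts c in (0,T], η = C(σ³/ξ + √ι/κ
+ κσ³) [= C′(φ/ξ + ε√ι/r + r/ℓ)], ν_c = average over independent uniform rotations of a_i about L_i⁻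
and a_j about L_j⁻ weighted by (approachSpeed)₊ — fresh LONGITUDES in the Palm/L¹ sense (TV ≤ √η off
a class of Palm frequency ≤ √η by Markov). What the repair changed: flux-tilted reference (the
contact law is Palm ∝ g₊); rotations about L⁻ instead of Haar (s_k = ⟨L_k,a_k⟩ is conserved forever
— inner_loadedImpact_snd_fst — and keeps its initial law while L_⊥ thermalises, so Haar is biased
O(|θ/θ₀−1|) out of equilibrium); NO exceptional class (geometric exclusions and same-pair
re-contacts both have φ-independent frequency: chattering is 4.0/7.4/11.3 % of impacts at ι = 0.1, ξ
= 0.2/0.3/0.4, ∝ ξ²/ι, two-body flux-weighted MC in REPAIR.md — with the full-circle reference the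
chatter impacts are booked with their parent, and rare bad sub-populations are absorbed by
normalising with the TOTAL contact count); N ≥ N₀; the coarse PRESENT (one frame) instead of the
coarse past at all frames (digital-line super-resolution of free flights would pin contact times and
phases at fixed κ as φ → 0). At global equilibrium both inequalities hold with η = 0 exactly
(Campbell + Haar-invariance of the contact-surface measure), so the content is molecular chaos for
the ANGULAR variables only. Engine: FejerWrapping on each incoming flight, whose duration is
uncertain by ≍ r/|V_i−V_j| given the coarse present (U ≍ √3κ/√ι ≫ 1 turns, defect √ι/κ; slow clocks
via E[1/|L|] < ∞), cell-wall leaks ξ/κ, recollision/ring correlations O(φ), r/ℓ ≍ κσ³; the rate kick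
(relative O(ξ/√ι)) re-randomises what short flights and slow clocks leave. Why it might fail:
flatness of f_t = f_0∘Φ_{−t} along the longitude circles given the coarse present is a chaos
property — the Palm weight of recollision/ring-correlated contacts must be O(φ) uniformly in N ≥ N₀
along the NON-equilibrium evolution (the ring sector every fixed-density card meets), and the
conditional law of flight durations must be TV-regular at the clock-period scale. Sources:
doi:10.1063/1.1733511, ChapmanCowling1970, Arnold1989, Kifer2009, Dolgopyat2005, CoxFeres2016,
GST2013, Spohn1991, doi:10.4007/annals.2017.185.1.5.
Rank 4, LoadedEulerRung (typed; packing-guarded since rev 12) — X_R as in § Thesis, in the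
conjunct's (re-typed, packing-guarded) format (∀ξ∀ι ∃η₀ ∀profiles ∃σ₀ ∀σ<σ₀ ∀ classical loaded-Euler
solutions on [0,T) with ρσ³ < η₀ throughout ∀ loaded flows: convergence of the three fields at t = 0
⇒ at every t < T). Intended proof (layer 2): (i) PhaseAveragedGibbsianity — regular
translation-invariant stationary states of the infinite-volume dynamics randomised by the
phase-AVERAGED kernel K̄_ξ (the longitudes of the two load phases redrawn ν-wise — flux-weighted
uniform rotations about L — once per ENCOUNTER (impacts + two-body flights until separation), the
conserved labels s_k = ⟨L_k,a_k⟩ carried as passive marks; conservative and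
Maxwellian⊗Gaussian-reversible by LoadedImpactInvolution + two-body Liouville) are
Gibbs⊗Haar⊗Gaussian mixtures (Liverani–Olla / FFL Dirichlet-form step + hard-core configurational
step); (ii) LoadedEntropyGronwall — Yau's Gronwall for H(f_t|ψ_t^load)/(N+1) with one-block input
PhaseFreshness + (i) at precision ω(η), two-block / LD from the UNCHANGED hard-sphere statics
(LoadedStatics), tail control of the |V|³ and |V||L|² currents; gives the δ(η)-accurate form (card
rung A), the exact form needing the shared ring-sector input (rung B). Why it might fail: N-uniform
coercivity of the K̄_ξ Dirichlet form per collision with UNBOUNDED velocities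
(Kac/Villani/Carlen–Carvalho constants) and the cubic energy-current tails along the loaded flow
(HighMomentumCutoffBarrierNarrow verbatim). Sources: OllaVaradhanYau1993, LiveraniOlla1996,
FritzFunakiLebowitz1994, Rezakhanlou2003, Yau1991, CarlenCarvalhoGabetta2000, NachtergaeleYau2003.
Rank 5, SlackRung (typed; the twice-repaired rank-5 rung: stmt-9341 'uniformly in κ'
refuted-misstated → per-κ TwoTemperatureRung stmt-14496 at 03:28Z, whose PINNED RATE c :=
loadedExchangeRate σ ι with EXACT convergence at fixed σ was refuted-misstated by refuter
rattack-14496-0 at 04:37Z, evidence Evidence14496.lean / CruxAttack14496.md / Repair14496.lean: the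
kernel-checked torque identity ΔL = ξε·a×ΔV makes Λ = L − ξε a×V, the angular momentum about the
GEOMETRIC centre, conserved at impacts, so the spin is driven secularly only through the rotating
lever and along ξ_N the exchange rate is the collisional force spectrum at the precession frequency
ω = |L|/(ιε²): true/Enskog = R(Θ) ≈ 9Θ²/(4+9Θ²) < 1, Θ = ωτ_free ≈ 0.23/(φ√ι) N-INDEPENDENT at fixed
σ (frozen lever: R = 0; R → 1 only as σ → 0; planner's check: S_F(ω) = ω²S_V(ω) with the Enskog
friction γ = (2/3)ν reproduces R exactly — the Landau–Teller/Zwanzig mechanism), and the slow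
generator is not affine in the active energy, so there is NO closed two-temperature law at fixed σ
and the translational energy field carries a deterministic bias ≍ κ²·O(φ²ι)|θtr − θrot|t off the
pinned solution) — THE SLACK RUNG, C′ of Repair14496.lean (packing-guarded since rev 11, as the
re-typed conjunct): ∀ι > 0 ∃η₀ > 0 ∀ profiles ∃σ₀(ι, profiles) ∀σ < σ₀ ∀T ∀ classical hs-Euler
solutions (ρ,u,θ) on [0,T) with ρσ³ < η₀ throughout — the CONJUNCT's system and the conjunct's guard
— ∀t ∈ [0,T) ∀χ ∀δ > 0 ∃κ₀ ∀κ ∈ (0,κ₀) ∀ loaded flows along ξ_N = loadedEccentricity κ N: the full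
three-field LLN at t = 0 under loadedLocalGibbsLaw σ ξ_N ι ⇒ the χ-tested translational fields at
time t are within δ of (ρ, ρu, ρ(‖u‖²/2 + 3θ/2))(t) with probability → 1. κ → 0 INSIDE the item
(after δ), N → ∞ first, N₀ may depend on κ, σ₀ before κ; no exchange-rate function and no
intermediate PDE — the rotational coupling enters the translational budgets at O(κ²) whatever its
(non-closed) law. It is exactly what the restated frame item Assembly (the swap) consumes, and not a
restatement of the conjunct (ξ_N > 0 at every N: the loaded and the true dynamics differ at every
N). Intended proof: Yau's relative entropy against the hs-Euler local Gibbs state ⊗ Gaussian angular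
momenta at the ADVECTED initial temperature (the κ = 0 case of D2,
isTwoTemperatureEulerSolution_zero_iff) ⊗ Haar, whose entropy production is the conjunct's plus an
O(κ²) exchange term: H_N(t)/N ≤ e^(Ct)(o(1) + Cκ²t), fields within O(κ) — given the SAME one-block /
ring-sector input the conjunct needs. Why it might fail: CONJUNCT-HARD and said so — along ξ_N → 0
the dice defect φ/ξ_N → ∞ (the clock randomises nothing at leading order: VanishingNoise's
interchange, stmt-AtomisticToContinuum-0812, in Hamiltonian clothing, made the LAST step, not an
easier one); and the O(κ²) drain must stay perturbative uniformly in N (slow rotors R → 0; long-time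
tails doi:10.1103/physreva.1.18). Sources: OllaVaradhanYau1993, Spohn1991, doi:10.1063/1.1733511,
ChapmanCowling1970, doi:10.1063/1.1731795, doi:10.1103/physreva.1.18.
Typed items follow; OneKickFootprint and ContactIntensityDominationOneRare precede LoadedTransfer so
the gate elaborates them in order.
#3 OneKickFootprint (crux) — ONE-KICK FOOTPRINT (Euler-scale linear response of the TRUE hard-sphere
gas to a local conservative kick is hydrodynamic). Conjunct's frame (profiles; σ < σ₀; classical
hs-Euler solution on [0,T); flows; local Gibbs data converging at t = 0); for every T′ < T and
Lipschitz χ there are C, N₀ such that for N ≥ N₀, |α| ≤ 1, t ∈ [0,T′]: kicking the INITIAL datum by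
rotating the relative velocity of particles 0 and 1 by the angle α towards their separation vector
(centre-of-mass velocity and relative speed kept: mass, momentum, kinetic energy exactly conserved)
WHENEVER they are within 2ε_N (probability ≍ σ³/(N+1)) changes the EXPECTED empirical density,
momentum and energy fields at time t tested against χ by at most C|α|(N+1)^(-7/3) — i.e.
O(|α|ε_N/(N+1)) per delivered kick: a dipole of conserved quantities with arm ≤ 2ε_N (then ≍ a mean
free path ≍ N^(-1/3)) propagated by linearised hydrodynamics acting on the smooth test function,
instead of O(|α|/(N+1)) for two freely streaming particles (ideal gas) or the fluctuation level
(N+1)^(-3/2) (trivial bound). [difficulty: open-problem] (why it might fail: The MEAN response of a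
chaotic deterministic gas must stay at the conserved-dipole size ε/N for macroscopic times; a kick
that biases the pair's LATER collisions (ring re-collisions, weight O(ρσ³)) or a slow
non-hydrodynamic mode gives C/N instead; false for the ideal gas.) [OllaVaradhanYau1993, Spohn1991,
BodineauGallagherSaintRaymondSimonella2023, doi:10.4007/annals.2023.198.3.3, LiveraniOlla1996]
#6 ContactIntensityDominationOneRare (crux) — THE ONE-RARE-PARTICIPANT CONTACT-INTENSITY CEILING
(repaired ContactIntensityDomination: stmt-9218 — the mark-uniform bound against the product of two
INDEPENDENT copies of the law, shared with SpeedCapSurgery and the retired AprioriTailsRattlers —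
was refuted-MISSTATED 2026-08-17 by Theorems.not_SpeedCapSurgery_ContactIntensityDomination,
hot-spot witness θ₀ x = 2 − ‖x‖ with TWO rare participants at ±Ve₁, V → ∞, window (0,h], h → 0:
mixture of products vs product of mixtures in the joint tail; the refuted record stays in the file
and was dropped from the cone). The refuter's repaired C′, variant (γ) of
Cruxes/EnergyCurrentTails/Lines/level_census_comparison_local_ceiling.lean, VERBATIM (stmt-16939):
along the deterministic flow from local Gibbs data at σ < σ₀, for T > 0 and any flow family there
are C < ⊤ and N₀ such that for N ≥ N₀, 0 ≤ s ≤ t ≤ T, k ≤ 3 and every continuous ψ ≥ 0, the expected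
collision sum over (s,t] of ψ(vᵢ⁻)(1+‖vⱼ⁻‖)^k is ≤ C·σ²(N+1)^(1/3)/(N+1) × ∫_s^t E⊗E[Σᵢⱼ
ψ(vᵢ)(1+‖v′ⱼ‖)^k ‖vᵢ − v′ⱼ‖] under the product of the time-τ laws — one arbitrary mark, the partner
only through a bulk moment (local/global moment ratio ≤ (θmax/θmin)^(k/2) sup ρ/inf ρ pre-shock, so
the inhomogeneous statics, rung ½, pass ψ-uniformly by construction; the alternative repair (α), the
one-copy cone-mollified LOCAL form ContactIntensityDominationLocal, is not needed by this route and
not filed). Here: the size control of LoadedTransfer's Lindeberg sum by monotonicity of the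
collision functional in the mark — kick budget Σ_contacts ξ_N|g| with |g| ≤ ‖v−w‖ ≤ (1+‖v‖)(1+‖w‖)
(ψ = 1+‖·‖, k = 1) ≍ ξ_N(N+1)^(4/3), and Σ ξ_N²|g|² with (1+‖v‖)²(1+‖w‖)² (k = 2) — the producer
shape of RateCeiling / energyFluxCeiling / MeanCollisionalImpulseBound on the board. [difficulty:
open-problem] (why it might fail: Off equilibrium nothing bounds the contact pair correlation at
positive density: transient dense clusters (rattlers) or ring re-collisions could make the
one-marked-particle collision intensity history-dependent and exceed C × Enskog at times O(1); only
rung 0/½ (statics) are certified.) [GST2013, Spohn1991, BodineauGallagherSaintRaymondSimonella2023,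
Alexander1975]
#9 EquilibriumKickResponse (support) — GLOBAL-EQUILIBRIUM special case of OneKickFootprint (profiles
a₀ ≡ 1, u₀ ≡ 0, θ₀ ≡ θe; any horizon T; same kick, fields and bound C|α|(N+1)^(-7/3)): a
Green–Kubo-type statement — mean field response at time t to a conserved dipole planted at time 0
under the invariant Gibbs law — the cheapest place to prove or refute the footprint. [deps:
OneKickFootprint] [difficulty: XL] [Spohn1991, BodineauGallagherSaintRaymondSimonella2023,
doi:10.4007/annals.2023.198.3.3]
#9 FejerWrapping (support) — FEJÉR WRAPPING (card E3a, provable now): if a real random variable τ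
has a probability density f with L¹-modulus ∫|f(x+h) − f(x)|dx ≤ L|h|, then for every frequency Ω >
0 and phase θ₀ the law of θ₀ + Ωτ mod 1 is within L/(4Ω) of Haar on the circle, set by set: |P(θ₀ +
Ωτ ∈ A) − |A|| ≤ L/(4Ω) for every measurable A ⊂ ℝ/ℤ (average the wrapped density over one period).
With f = s⁻¹F(·/s) this is the card's C/(Ωs). [difficulty: provable-now] [Arnold1989, Kifer2009]
#9 LoadedImpactInvolution (support) — FAIR-DICE MECHANICS (card S1, provable now; fixes the
collision law of D1): for diameter ε > 0, eccentricity ξ ≥ 0, isotropic inertia ιε², unit masses,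
unit vectors a_i, a_j (mass centre → geometric centre) and contact normal n (i → j), the two-body
impact map Λ on (V_i,V_j,L_i,L_j) — g_n = ⟨n,V_i − V_j⟩ + ξε(⟨n,ω_i×a_i⟩ − ⟨n,ω_j×a_j⟩), ω =
L/(ιε²); J = 2g_n/(2 + (ξ²/ι)((1 − ⟨a_i,n⟩²) + (1 − ⟨a_j,n⟩²))); V_i ↦ V_i − Jn, V_j ↦ V_j + Jn, L_i
↦ L_i − Jξε(a_i×n), L_j ↦ L_j + Jξε(a_j×n) — conserves V_i + V_j and |V_i|²/2 + |V_j|²/2 + (|L_i|² +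
|L_j|²)/(2ιε²), reverses g_n, and is an involution (being linear, it then preserves Lebesgue
measure: Liouville⊗Gaussian invariance and detailed balance of K̄_ξ follow by Haar-averaging).
[difficulty: provable-now] [doi:10.1063/1.1733511, ChapmanCowling1970, CoxFeres2016]
#9 LoadedTransfer (support) — THE CONSUMER (typed shadow of the card's leg (C); restated 2026-08-17
over the repaired budget, stmt-16943): OneKickFootprint → ContactIntensityDominationOneRare →
HydrodynamicLimit (the sub-problem Statement decl). Intended proof = the loaded programme: for κ <
κ₀(t, χ, δ/2), SlackRung puts the χ-tested translational fields of LS(σ, κ(N+1)^(-1/6), ι) at time t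
within δ/2 of the conjunct's Euler solution with probability → 1, and a Lindeberg/Duhamel swap in ξ
∈ [0, κ(N+1)^(-1/6)] at the same N — the restated frame item Assembly — (d/dξ E_ξ[F(fields_t)] =
Σ_contacts E[(∂_ξ outcome)·(footprint)], footprint bound assumed UNIFORM along the loaded family,
contact budget from ContactIntensityDominationOneRare with the marks ψ = 1+‖·‖, k = 1 and ψ =
(1+‖·‖)², k = 2) puts the true gas's field laws within O(κ(N+1)^(-1/6)) + O(κ²) of the loaded ones;
N → ∞, then κ → 0. In substance as hard as the conjunct (contains SlackRung); filed so that the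
Assembly is pure logic and the two typed true-gas inputs are refutable now. [deps: OneKickFootprint,
ContactIntensityDominationOneRare] [difficulty: open-problem] [OllaVaradhanYau1993,
ChenLevermoreLiu1994, Spohn1991]

TWO-LAYER PLAN. Foreseen glued splits (k ≤ 3, depth 1), none filed now. PhaseFreshness ⇐
FlightTimeFejer (given the coarse present and the exact pair data, the conditional law of each
partner's incoming flight duration has total variation ≍ (width)⁻¹ at the clock-period scale ε√ι/v,
width ≍ r/|V_i−V_j|; then FejerWrapping gives longitude defect √ι/κ, slow clocks via E[1/|L|] < ∞;
the kicked-top expansion — a ↦ a_next expands area by ≍ cξℓ′/(ει) off {a ∥ n} — is the re-randomiser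
of what short flights leave) → RingWeight (the Palm weight of contacts whose incoming flights are
recollision/ring-correlated with the phases is ≤ Cφ uniformly in N ≥ N₀ along the evolution) →
PhaseFreshness (Campbell bookkeeping over encounters, cell-wall leak ξ/κ). LoadedEulerRung ⇐
PhaseAveragedGibbsianity → LoadedEntropyGronwall → LoadedEulerRung. OneKickFootprint ⇐
EquilibriumKickResponse (filed) → KineticToHydroRelaxation (the kicked pair's perturbation relaxes
in mean onto the five conserved fields within O(1) mean free times) → OneKickFootprint (linearised
hs-Euler on the test function, pre-shock). SlackRung ⇐ (foreseen, not filed) SlackEntropyGronwall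
(Yau's Gronwall against the hs-Euler ⊗ advected-θrot ⊗ Haar reference with an O(κ²) defect) + the
conjunct-hard one-block input along ξ_N; not split before LoadedEulerRung moves.

KILL CRITERIA. (1) ¬PhaseFreshness in its cheapest form — NON-equilibrium MD of LS (temperature-step
relaxation; φ ∈ {0.01, 0.05}, ξ ∈ {0.2, 0.4}, ι = 0.1, κ ∈ {4, 16}) showing a normalised Campbell
discrepancy Σ_c[G − ν_c(G)]/#contacts, for cell-binned longitude harmonics G, that does NOT scale
like σ³ + √ι/κ + κσ³, or drifts with N (equilibrium MD is a null test — the identity is exact there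
— and a comparison with plain Haar only re-finds the 1–4 % flux signal of the crux-attack) — kills
the dice engine: close `refuted:PhaseFreshness` (X_R dies; OneKickFootprint survives as a statement
wanted by the swap routes). (2) ¬OneKickFootprint (mean response ≍ (N+1)^(-2), i.e. 1/N per
delivered kick — e.g. from ring re-collisions at positive ρσ³ — or already ¬EquilibriumKickResponse)
kills LoadedTransfer AND every kick-by-kick comparison on the board (VanishingNoise (ii),
SpecularLambertianSwap.SwapGap in Lindeberg form): close `refuted:OneKickFootprint`, hand the
witness over as negative knowledge; X_R survives only as an analogue theorem (re-file it
Literature-side and retire the route here). (3) ContactIntensityDomination as first typed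
(mark-uniform, two independent copies) WAS refuted-misstated on 2026-08-17 (hot-spot witness) and
repaired as ContactIntensityDominationOneRare; ¬ContactIntensityDominationOneRare — a
one-marked-particle collision intensity exceeding C × Enskog off equilibrium, substantively — kills
LoadedTransfer's budget here and every Enskog-ceiling producer on the board (RateCeiling,
energyFluxCeiling, MeanCollisionalImpulseBound): close `refuted:ContactIntensityDominationOneRare`
unless the verdict is again `misstated` with a consumable C″ (then restate once more; a third
misstatement of the budget retires X_T's typed transfer and leaves OneKickFootprint / X_R as
statements). (4) ¬LoadedImpactInvolution (an algebra slip) forces a restate of D1's collision map,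
not a close. Mooted: HydrodynamicLimit proved elsewhere moots LoadedTransfer/Assembly only.
Superseded: VanishingNoise's StochasticStability (0812) proved with a budget covering κ² exchanges
per particle per unit time gives SlackRung from LoadedEulerRung-type inputs — re-rank, do not close.
(5) The rank-5 rung has been restated twice as MISSTATED (κ-uniformity, 03:28Z; pinned Enskog rate,
05Z); a verdict that SlackRung itself is false, or misstated beyond a restate the swap can consume,
retires X_T here: close `refuted:SlackRung` (X_R and OneKickFootprint survive as statements,
re-filed where wanted).

NOT DECOMPOSED YET. Everything loaded beyond the three loaded cruxes: the infinite-volume objects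
for PhaseAveragedGibbsianity (marked regular stationary states, D3 of route AnosovRotorDice with
marks (a,L); not re-filed), the loaded tail input (|V|³, |V||L|² currents), the two foreseen
children of PhaseFreshness (FlightTimeFejer, RingWeight), the ENCOUNTER map as an object
(chattering: same-pair re-contacts are 4–11 % of impacts at ι = 0.1, ξ = 0.2–0.4, ∝ ξ²/ι; its
flux-weighted longitude average is K̄_ξ; an expected-multiplicity bound is not filed), the passive
label field s = ⟨L,a⟩ (frozen third rotational degree of freedom, advected), C and the ι-dependence
(ι → 0: fast light clock, large kicks; ι large: slow clock), triaxial loads (Euler-top clock, e = 3θ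
— same mechanism, not filed), the phase-averaged kernel gas K̄_ξ as a stochastic rung of its own
(angular-noise-ladder's territory), the uniform-in-ξ footprint along the loaded family (needs D1),
kick-at-time-s versions of OneKickFootprint, the fixed-σ macroscopic law of the vanishing-load
family (translational hydrodynamics ⊗ a Landau–Teller spin diffusion in L with rate
R(Θ(|L|))·Enskog, not closed in two temperatures — CruxAttack14496.md §2; recorded as negative
knowledge about loadedExchangeRate, not filed), the quantitative form of SlackRung (slack Cκ² on
[0,T′] for normalised Lipschitz χ — needs a norm on χ and is not what Assembly consumes; not filed),
κ-uniformity of SlackRung's κ₀/N₀ (NOT filed: restates the conjunct), the value of the packing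
threshold η₀ in SlackRung / LoadedEulerRung (prover-chosen, ∃ outermost after the load parameters
exactly as in the re-typed conjunct; the relative-entropy references need only that the solution
stays where the virial EOS is analytic and (ρ,θ) ↦ activity inverts — Ruelle1969 §3.4; no number is
pinned), loaded-flow EXISTENCE on 𝕋³ for ξ > 0 (Alexander's scheme; it makes the ∀Ψ items
non-vacuous; a provable-now support to be filed for an idle prover), and the negative side
(¬SlackRung would be evidence about the conjunct itself; not filed before X_R moves).
TwoTemperaturePDE (stmt-AtomisticToContinuum-9378, informal support) was DROPPED at the
2026-08-16T05Z repair: the κ > 0 two-temperature system is on no path any more (its κ = 0 case,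
hs-Euler + advected θrot, stays in D2 as SlackRung's entropy reference).

CHEAPEST FALSIFIER. Pen and paper first (an hour): (i) kicked-top bookkeeping — with ⟨|L|²⟩ = 3ιε²θ,
|ω| = |L|/(ιε²), flight time ℓ/ḡ, check Θ ≈ 0.225/(φ√ι) and that ΔL = Jξε|a×n| changes |L| by a
RELATIVE O(ξ/√ι) with non-degenerate 2-D dependence on a (if the rate kick were O(ξ²) or
one-dimensional, Λ ≲ 1 at φ = 0.05 and PhaseFreshness loses its engine); (ii) footprint arithmetic —
instantaneous conditional response |α|·E|g|·Kε_N/(N+1) and the free-streaming counterexample (ideal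
gas: |α|(χ(x₁+v₁t) − χ(x₀+v₀t))/(N+1) = O(|α|/N) once t ≫ ε/|g|), confirming OneKickFootprint is
false at σ = 0 and so says something. Then ONE kit job (not run: planner seat): event-driven MD, N =
10⁴–10⁵ loaded spheres, ι = 0.1, ξ ∈ {0, 0.2, 0.4}, φ ∈ {0.01, 0.05}: (a) out of equilibrium
(temperature step), contact statistics against the flux-tilted longitude reference ν of
PhaseFreshness — cell-binned longitude harmonics, normalised by the contact count — must scale like
σ³ + √ι/κ + κσ³, N-independently (at equilibrium the comparison is an exact identity and only
validates the code); (a′) the encounter multiplicity (chattering fraction ≈ 0.07 of impacts at ξ =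
0.3, ι = 0.1 by the repair's two-body MC) reproduced in the gas; (b) at equilibrium plant conserved
dipoles (α = 0.3) on all pairs closer than 2ε at t = 0 and measure the mean momentum-field response
at t = 0.2, 0.5, 1 against χ = sin(2πx₁): ε/N per kick, not 1/N (EquilibriumKickResponse); (c) the
θ_rot/θ_tr relaxation rate against (4/3)νξ²/ι × R(Θ), R ≈ 9Θ²/(4+9Θ²) (the crux-attack's
Boltzmann-level toy MC, kit job j012844 on stmt-14496, is the first data point).

NUMBERS. Scaling: ε_N = σ(N+1)^(-1/3), (N+1)ε_N³ = σ³, φ = ρσ³; ≍(N+1)^(1/3) contacts per particle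
per unit time, ≍(N+1)^(4/3) in total. Mean free path ℓ/ε = 1/(√2πφ) = 4.50 (φ = 0.05), 22.5 (φ =
0.01). Clock: ⟨|L|²⟩ = 3ιε²θ, |ω| ≈ √(3θ/ι)/ε, turn per flight Θ ≈ 0.225/(φ√ι) = 14.2 rad (φ = 0.05,
ι = 0.1), 71 rad (φ = 0.01). Kick: J ≈ g_n(1 + O(ξ²/ι)), |ΔL|/|L| ≈ ξ/√(3ι) = 0.55 (ξ = 0.3, ι =
0.1); expansion per contact Λ ≈ 0.225ξ/(φι) = 13.5 (φ = 0.05), 67 (φ = 0.01); dice defect η = C(σ³/ξ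
+ √ι/κ + κσ³) [= C′(φ/ξ + ε√ι/r + r/ℓ)], Fejér uncertainty U ≍ √3κ/√ι turns per flight at coarse
scale r = κε; chattering (same-pair re-contact) fraction of impacts 0.040/0.074/0.113 (ι = 0.1, ξ =
0.2/0.3/0.4), 0.298 (0.3, 0.02), 0.012 (0.3, 0.4) — two-body flux-weighted MC, φ → 0; no exceptional
class. Rot–trans energy exchange O(ξ) per contact, random sign ⇒ equilibration after ≍ ξ⁻² contacts
= ξ⁻²(N+1)^(-1/3) macroscopic time; ξ_N = κ(N+1)^(-1/6) ⇒ O(1) rate κ²c·R̄ ≤ κ²c, R(Θ) ≈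
9Θ²/(4+9Θ²): 1 − R = 2.2·10⁻³ (Θ = 14.2: φ = 0.05, ι = 0.1), 8.8·10⁻⁵ (Θ = 71: φ = 0.01) — small but
nonzero at every fixed σ, whence no pinned rate. Loaded Euler: E = ρ(|u|²/2 + 5θ/2), ideal-part
exponent 7/5 < 5/3 (sub-characteristic ordering). Transfer: first-order Lindeberg sum ≍ ξ_N; second
order ξ_N²(N+1)^(1/3) = κ². Footprint: P(particles 0,1 within 2ε_N) ≈ (28π/3)σ³·(contact
value)·∫ρ₀²/(N+1); instantaneous conditional momentum response ≤ |α|·E|g|·K·ε_N/(N+1); claimed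
uniform bound C|α|(N+1)^(-7/3); fluctuation level (N+1)^(-3/2); ideal-gas value ≍ |α|(N+1)^(-2).
Items: 12 ≤ 15 active after the 2026-08-17 repair (all typed; TwoTemperaturePDE dropped 08-16, the
refuted ContactIntensityDomination dropped 08-17, LoadedFlowExistence added 08-16).

DEFINITION REQUESTS. All LANDED 2026-08-15 (original request texts: git history, rev ≤ 3). (D1)
`loadedImpact` (EXACTLY the map of support LoadedImpactInvolution), `LoadedSphereFlow G ε ξ ι N`
(mirrors HardSphereFlow: good set, group property, measurability, loadedLiouville preserved),
`loadedLocalGibbsLaw σ ξ ι a₀ u₀ θ₀ N` (hs canonical density of the projection × Gaussian angular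
momenta at θ₀, Haar loads), `LoadedSphereFlow.configFlow` feeding the library's three empirical
fields — Literature.Analysis.FluidPDE.LoadedSphereDynamics; flow EXISTENCE on 𝕋³ for ξ > 0
(Alexander's scheme) stays a SEPARATE statement, never a field. (D2) `IsLoadedEulerSolution σ T ρ u
θ` (E = ρ(‖u‖²/2 + 5θ/2)) and `IsTwoTemperatureEulerSolution σ κ c T ρ u θtr θrot` (θtr in
hsPressure; tr-energy source −κ²cρ(θtr − θrot); ∂ₜ(ρθrot) + div(ρθrot u) = +κ²cρ(θtr − θrot);
`IsExchangeRate c`; κ = 0 ⇔ hs-Euler + advected θrot, `isTwoTemperatureEulerSolution_zero_iff`) —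
Literature.MathematicalPhysics.KineticTheory.TwoTemperatureEuler. (D2′) `loadedExchangeRate σ ι` =
(16√π/(3ι))χ(ρσ³)ρσ²√θtr (Enskog translation–rotation rate re-derived from loadedImpact; cf.
Dahler–Sather doi:10.1063/1.1733511) and `loadedEccentricity κ N` = κ(N+1)^(-1/6) with
ξ_N²(N+1)^(1/3) = κ² — Literature.MathematicalPhysics.KineticTheory.LoadedExchangeRate (route import
added at the 2026-08-16 repair); since the 05Z repair only loadedEccentricity is named by an item —
loadedExchangeRate is the σ → 0 ASYMPTOTIC of the fixed-σ exchange law (R(Θ)·Enskog, non-closed;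
refuter rattack-14496-0) and keeps that reading in the Literature file. (D3) not filed: marked
`RegularStationaryState` — AnosovRotorDice's request covers it once marks (a,L) are allowed. Cite
fact: none wanted now (Yong's relaxation limit doi:10.1006/jdeq.1998.3584 lost its consumer with
TwoTemperaturePDE).

Novelty: Searches (2026-08-15; searchd rc 75 twice and OpenAlex/arXiv HTTP 429 during the session, logged in
NOTES.md): `lit frontier AtomisticToContinuum --since 2020` (30 rows: the only deterministic
hydrodynamic-type limit is arXiv:2310.13338, diffusive; nothing with rotational degrees of freedom);
`lit bridges AtomisticToContinuum --cross any` (30 rows, none relevant); `lit search --source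
crossref "Dahler Sather kinetic theory of loaded spheres"` (10: doi:10.1063/1.1733511,
doi:10.1063/1.1697003, doi:10.1063/1.1841253, doi:10.1063/1.1712279 — loaded spheres I–IV,
Boltzmann/Enskog level, chaos assumed); `lit search "Blumenthal Xue Young Lyapunov exponents random
perturbations standard map"` (local 10 + remote 12: doi:10.4007/annals.2017.185.1.5,
doi:10.1007/s00220-017-2999-2, arXiv:2004.10626); `lit search --source crossref "hydrodynamic limit
hard spheres with rotation rough spheres rigorous Euler"` (12, none rigorous: granular/ET moment
closures only, e.g. doi:10.1103/physreve.81.066307); `lit search --source crossref "Yong singular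
perturbations hyperbolic stiff source"` (doi:10.1006/jdeq.1998.3584); `lit search --source crossref
"polyatomic gas two temperatures hyperbolic relaxation Ruggeri"` (doi:10.1103/physreve.96.042143,
the ET6 two-temperature system); `lit galaxy search "loaded sphere(s)" --star all` (20 rows, all
noise); held books read: book:chapman1970-mathematical-theory-non-uniform-gases-account-kinetic p.
200 (§11.1, the eccentric smooth sphere as "the next simples  [refs: 10.1063/1.1733511, 10.1063/1.1697003, 10.1063/1.1841253, 10.1063/1.1712279, 10.4007/annals.2017.185.1.5, 10.1007/s00220-017-2999-2, 10.1103/physreve.81.066307, 10.1006/jdeq.1998.3584, 10.1103/physreve.96.042143, 2310.13338, 2004.10626, doi:10.1063/1.1733511, doi:10.1063/1.1697003, doi:10.1063/1.1841253, doi:10.1063/1.1712279, doi:10.4007/annals.2017.185.1.5, doi:10.1007/s00220-017-2999-2, doi:10.1]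

Barriers (technique_class: fast-phase-averaging, lindeberg-swap, relative-entropy): - technique_class: fast-phase-averaging, lindeberg-swap, relative-entropy
- Literature.Barriers.AtomisticToContinuum.BoltzmannHypothesisBarrier: for the LOADED gas the
angular half of molecular chaos is DERIVED (PhaseFreshness) and a classification of stationary
states is asked only of the phase-AVERAGED stochastic kernel K̄_ξ (Liverani–Olla/FFL type, evasion
(i) with the noise manufactured by the Hamiltonian clock); the barrier's formal kernel is respected
twice: with no collisions the clock is never read (ideal gas: nothing claimed), and OneKickFootprint
is FALSE for free flight (footprint 1/N, not ε/N). For the conjunct proper the barrier is not evaded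
but relocated, honestly, into SlackRung (rank 5, the twice-repaired TwoTemperatureRung: the
vanishing-load rung to the conjunct's own Euler solution).
- Literature.Barriers.AtomisticToContinuum.BoltzmannHypothesisBarrierNarrow: the flux-level closure
is obtained for LS via PhaseFreshness + PhaseAveragedGibbsianity, not assumed; for the true gas the
route consumes no closure at all — its typed true-gas inputs are a linear-response bound
(OneKickFootprint) and a one-sided Stosszahlansatz CEILING for one-rare-participant marks
(ContactIntensityDominationOneRare, stmt-16939 — the 2026-08-17 repair of
ContactIntensityDomination, whose mark-uniform two-copy form was refuted-misstated by the hot-spot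
witness; a ceiling on collision intensity, not a closure of the collision term), both outside the
narrowed technique class; the closu

Novelty grade: new-combination — REVIEW rreview-0815T13-14-0: JeansLoadedDice = conforming re-filing of retired LoadedDice (D-0027 technicality; not a recombination of closed routes). Module builds (gate-written `closes` present); 6 probes rc0 + assembly_holds sorry-free (W_jeans.lean, std axioms); the 7 typed items were CHECKED by (refuter refuter-rreview-0815T13-14-0, 2026-08-15T14:29:13Z; prior: doi:10.1063/1.1733511, doi:10.1063/1.1697003, OllaVaradhanYau1993, doi:10.4007/annals.2017.185.1.5, ChapmanCowling1970)

History (route lifecycle, newest last):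
- 2026-08-16T23:15:21Z · rev 11: restated SlackRung (stmt-AtomisticToContinuum-14681) — route-repair (statement-revised p126922: HydrodynamicLimit re-typed to the PACKING-GUARDED def, D-0032): SlackRung re-typed with the conjunct's guard verbatim ( (planner-rrepair-AtomisticToContinuum-JeansLoad-694f531d-0)
- 2026-08-16T23:15:50Z · rev 12: restated LoadedEulerRung (stmt-AtomisticToContinuum-9339) — route-repair (statement-revised p126922, packing-guarded HydrodynamicLimit): LoadedEulerRung (the analogue rung X_R, 'the conjunct's format' at fixed load) re-t (planner-rrepair-AtomisticToContinuum-JeansLoad-694f531d-0)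
- 2026-08-17T00:29:21Z · BROKEN — ContactIntensityDomination (stmt-AtomisticToContinuum-9218, crux) refuted by Summit.AtomisticToContinuum.HydrodynamicLimit.Theorems.not_SpeedCapSurgery_ContactIntensityDomination @ 5976b5e32bfa (prover-line-stmt-AtomisticToContinuum-9235-c4-0)
- 2026-08-17T00:49:15Z · rev 15: restated Assembly (stmt-AtomisticToContinuum-14682) — repair 2/4 — restate the frame item Assembly (the Lindeberg swap; stmt-14682 had become vacuously true with the refuted ContactIntensityDomination as a hypothes (operator:999:1078242)
- 2026-08-17T00:49:53Z · rev 16: restated LoadedTransfer (stmt-AtomisticToContinuum-9222) — repair 3/4 — restate the consumer LoadedTransfer (stmt-9222 had become vacuously true with the refuted ContactIntensityDomination as a hypothesis) over the repa (operator:999:1112572)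
- 2026-08-17T00:50:44Z · rev 17: dropped ContactIntensityDomination — repair 4/4 — drop the REFUTED ContactIntensityDomination (stmt-AtomisticToContinuum-9218, refuted-misstated by Theorems.not_SpeedCapSurgery_ContactIntensityDomi (operator:999:1144883)
- 2026-08-17T00:50:44Z · REPAIRED (drop ContactIntensityDomination) — back to open: repair 4/4 — drop the REFUTED ContactIntensityDomination (stmt-AtomisticToContinuum-9218, refuted-misstated by Theorems.not_SpeedCapSurgery_ContactIntensityDomi (operator:999:1144883)
- 2026-08-26T14:59:12Z · DORMANT — reconciler: no traction for 6.7 d (last activity item-proof-filed at 2026-08-19T22:27:22Z); parked, not closed — `ledger route dormant route-AtomisticToContinuu (operator:999:3728307)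

sub-problem: HydrodynamicLimit · status: dormant · opened planner-plancard-AtomisticToContinuum-Hydrody-f6396ded-0 2026-08-15T13:52:49Z · rev 20 · ledger route-AtomisticToContinuum-JeansLoadedDice
GENERATED by the gate from the ledger (D-0016/17). Provers cite these decls: `theorem foo : Summit.AtomisticToContinuum.HydrodynamicLimit.Theses.JeansLoadedDice.<Decl> := …` in Summits/AtomisticToContinuum/HydrodynamicLimit/Theorems/<Name>.lean.
-/

namespace Summit.AtomisticToContinuum.HydrodynamicLimit.Theses.JeansLoadedDice

open scoped BigOperators Topology Manifold Classical MeasureTheory ProbabilityTheory Matrix InnerProductSpace ComplexConjugate ContinuousMap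
open Filter Set Function TopologicalSpace MeasureTheory

attribute [summit_statement] _root_.HydrodynamicLimit

open Literature.Analysis.FluidPDE Literature.MathematicalPhysics.KineticTheory

/-- item stmt-AtomisticToContinuum-14565 · crux · rank 2 · open · by planner
why it might fail: Flatness of f_t along the two longitude circles given the coarse present is molecular chaos for the angles: out of equilibrium f_0∘Φ_(-t) is filamented and ring/recollision events correlate phase with configuration; their weight must be O(φ) uniformly in N ≥ N₀, cell-wall/slow-clock leaks O(1/κ).
sources: doi:10.1063/1.1733511, ChapmanCowling1970, Arnold1989, Kifer2009, Dolgopyat2005, CoxFeres2016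
[crux] CONDITIONAL LONGITUDE FRESHNESS AT CONTACTS, flux-weighted Campbell form (repaired
PhaseFreshness; card loaded-dice-jeans-spheres E3, the dice engine). LS(σ,ξ,ι) of D1
(LoadedSphereFlow on 𝕋³, ε_N = hsDiameter σ N, data loadedLocalGibbsLaw σ ξ ι a₀ u₀ θ₀), ξ ∈
(0,1/2), ι > 0, continuous positive profiles and a horizon T > 0 FIXED. CLAIM: ∃ C, σ₀ such that for
σ < σ₀, every coarse scale r = κε_N (κ ≥ 1), every family of loaded flows and N ≥ N₀(σ,κ,flows), for
every measurable weight G ∈ [0,1] of (⌊τ/r⌋; the r-cells of the PRE-contact positions and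
mass-centre velocities of ALL N+1 particles; the ordered pair (i,j); the exact normal n; the exact
pre-contact pair data p⁻ = ((V_i,V_j),(L_i,L_j)) = loadedPostData of the post-contact state
(involution); the phases a_i, a_j): |E Σ_c G_c − E Σ_c ν_c[G_c]| ≤ η · E #{c}, the sums over ALL
ordered contacts c in (0,T], η = C(σ³/ξ + √ι/κ + κσ³) [= C′(φ/ξ + ε√ι/r + r/ℓ)], where ν_c averages
G_c(·,·) over INDEPENDENT UNIFORM ROTATIONS of a_i about L_i⁻ and a_j about L_j⁻ (rodrigues),
weighted by (approachSpeed ε ξ ι (R_α a_i) (R_β a_j) n p⁻)₊ and normalised. Equivalently: the N-body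
law on the contact surface is flat, in the Palm/L¹ sense -/
@[route_item "route-AtomisticToContinuum-JeansLoadedDice"]
def PhaseFreshness : Prop :=
  open Literature.MathematicalPhysics.KineticTheory Literature.Analysis.FluidPDE in ∀ (ξ ι : ℝ), 0 < ξ → ξ < 2⁻¹ → 0 < ι → ∀ (a₀ θ₀ : T3 → ℝ) (u₀ : T3 → V3), Continuous a₀ → Continuous θ₀ → Continuous u₀ → (∀ x, 0 < a₀ x) → (∀ x, 0 < θ₀ x) → ∀ T : ℝ, 0 < T → ∃ C : ℝ, 0 < C ∧ ∃ σ₀ : ℝ, 0 < σ₀ ∧ ∀ σ : ℝ, 0 < σ → σ < σ₀ → ∀ κ : ℝ, 1 ≤ κ → ∀ Ψ : (N : ℕ) → LoadedSphereFlow (Torus.geometry (Fin 3)) (hsDiameter σ N) ξ ι (N + 1), ∃ N₀ : ℕ, ∀ N : ℕ, N₀ ≤ N → let geo := Torus.geometry (Fin 3); let ε : ℝ := hsDiameter σ N; let r : ℝ := κ * ε; let P : Measure (LoadedConfig (N + 1) T3) := loadedLocalGibbsLaw σ ξ ι a₀ u₀ θ₀ N (Ψ N); let η : ENNReal := ENNReal.ofReal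 (C * (σ ^ 3 / ξ + Real.sqrt ι / κ + κ * σ ^ 3)); let traj : LoadedConfig (N + 1) T3 → ℝ → Config (N + 1) (Fin 3) T3 := fun z t => loadedProjection ((Ψ N).flow t z); let cellX : T3 → (Fin 3 → ℤ) := fun x l => ⌊(Torus.reprSym x) l / r⌋; let cellV : V3 → (Fin 3 → ℤ) := fun v l => ⌊v l / r⌋; let obs : LoadedConfig (N + 1) T3 → Fin (N + 1) → (Fin 3 → ℤ) × (Fin 3 → ℤ) := fun y k => (cellX ((loadedProjection y) k).1, cellV ((loadedProjection y) k).2); let isContact : LoadedConfig (N + 1) T3 → ℝ → Fin (N + 1) → Fin (N + 1) → Prop := fun z t i j => i ≠ j ∧ traj z t ∈ contactSet geo (N + 1) ε i j; let tilt : V3 → V3 → V3 → ((V3 × V3) × (V3 × V3)) → (V3 → V3 → ENNReal) → ENNReal := fun ai aj n p h => let Ri : ℝ → V3 := fun α => rodrigues (‖p.2.1‖⁻¹ • p.2.1) α ai; let Rj : ℝ → V3 := fun β => rodrigues (‖p.2.2‖⁻¹ • p.2.2) β aj; let w : ℝ → ℝ → ℝ := fun α β => max (approachSpeed ε ξ ι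 (Ri α) (Rj β) n p) 0; (ENNReal.ofReal (∫ α in Ioc 0 (2 * Real.pi), ∫ β in Ioc 0 (2 * Real.pi), w α β))⁻¹ * ∫⁻ α in Ioc 0 (2 * Real.pi), ∫⁻ β in Ioc 0 (2 * Real.pi), h (Ri α) (Rj β) * ENNReal.ofReal (w α β); ∀ G : ℕ → (Fin (N + 1) → (Fin 3 → ℤ) × (Fin 3 → ℤ)) → Fin (N + 1) → Fin (N + 1) → V3 → ((V3 × V3) × (V3 × V3)) → V3 → V3 → ENNReal, (∀ m o i j n p a b, G m o i j n p a b ≤ 1) → Measurable (fun x : ℕ × (Fin (N + 1) → (Fin 3 → ℤ) × (Fin 3 → ℤ)) × Fin (N + 1) × Fin (N + 1) × V3 × ((V3 × V3) × (V3 × V3)) × V3 × V3 => G x.1 x.2.1 x.2.2.1 x.2.2.2.1 x.2.2.2.2.1 x.2.2.2.2.2.1 x.2.2.2.2.2.2.1 x.2.2.2.2.2.2.2) → let A : ENNReal := ∫⁻ z, (∑ᶠ τ ∈ collisionTimes geo ε (traj z) ∩ Ioc 0 T, ∑ i : Fin (N + 1), ∑ j : Fin (N + 1), if isContact z τ i j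 then G ⌊τ / r⌋₊ (obs (loadedCollide geo ε ξ ι i j ((Ψ N).flow τ z))) i j (loadedNormal geo ((Ψ N).flow τ z) i j) (loadedPostData geo ε ξ ι ((Ψ N).flow τ z) i j) (((Ψ N).flow τ z) i).2.1 (((Ψ N).flow τ z) j).2.1 else 0) ∂P; let B : ENNReal := ∫⁻ z, (∑ᶠ τ ∈ collisionTimes geo ε (traj z) ∩ Ioc 0 T, ∑ i : Fin (N + 1), ∑ j : Fin (N + 1), if isContact z τ i j then tilt (((Ψ N).flow τ z) i).2.1 (((Ψ N).flow τ z) j).2.1 (loadedNormal geo ((Ψ N).flow τ z) i j) (loadedPostData geo ε ξ ι ((Ψ N).flow τ z) i j) (G ⌊τ / r⌋₊ (obs (loadedCollide geo ε ξ ι i j ((Ψ N).flow τ z))) i j (loadedNormal geo ((Ψ N).flow τ z) i j) (loadedPostData geo ε ξ ι ((Ψ N).flow τ z) i j)) else 0) ∂P; let M : ENNReal := ∫⁻ z, (∑ᶠ τ ∈ collisionTimes geo ε (traj z) ∩ Ioc 0 T, ∑ i : Fin (N + 1), ∑ j : Fin (N + 1), if isContact z τ i j then (1 : ENNReal) else 0)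 ∂P; A ≤ B + η * M ∧ B ≤ A + η * M

/-- item stmt-AtomisticToContinuum-9217 · crux · rank 3 · open · by planner
why it might fail: The MEAN response of a chaotic deterministic gas must stay at the conserved-dipole size ε/N for macroscopic times; a kick that biases the pair's LATER collisions (ring re-collisions, weight O(ρσ³)) or a slow non-hydrodynamic mode gives C/N instead; false for the ideal gas.
sources: OllaVaradhanYau1993, Spohn1991, BodineauGallagherSaintRaymondSimonella2023, doi:10.4007/annals.2023.198.3.3, LiveraniOlla1996
[crux] ONE-KICK FOOTPRINT (Euler-scale linear response of the TRUE hard-sphere gas to a local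
conservative kick is hydrodynamic). Conjunct's frame (profiles; σ < σ₀; classical hs-Euler solution
on [0,T); flows; local Gibbs data converging at t = 0); for every T′ < T and Lipschitz χ there are
C, N₀ such that for N ≥ N₀, |α| ≤ 1, t ∈ [0,T′]: kicking the INITIAL datum by rotating the relative
velocity of particles 0 and 1 by the angle α towards their separation vector (centre-of-mass
velocity and relative speed kept: mass, momentum, kinetic energy exactly conserved) WHENEVER they
are within 2ε_N (probability ≍ σ³/(N+1)) changes the EXPECTED empirical density, momentum and energy
fields at time t tested against χ by at most C|α|(N+1)^(-7/3) — i.e. O(|α|ε_N/(N+1)) per delivered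
kick: a dipole of conserved quantities with arm ≤ 2ε_N (then ≍ a mean free path ≍ N^(-1/3))
propagated by linearised hydrodynamics acting on the smooth test function, instead of O(|α|/(N+1))
for two freely streaming particles (ideal gas) or the fluctuation level (N+1)^(-3/2) (trivial
bound). [difficulty: open-problem] -/
@[route_item "route-AtomisticToContinuum-JeansLoadedDice", crux]
def OneKickFootprint : Prop :=
  open Literature.MathematicalPhysics.KineticTheory Literature.Analysis.FluidPDE in ∀ (a₀ θ₀ : T3 → ℝ) (u₀ : T3 → V3), Continuous a₀ → Continuous θ₀ → Continuous u₀ → (∀ x, 0 < a₀ x) → (∀ x, 0 < θ₀ x) → ∃ σ₀ : ℝ, 0 < σ₀ ∧ ∀ σ : ℝ, 0 < σ → σ < σ₀ → ∀ (T : ℝ) (ρ θ : ℝ → T3 → ℝ) (u : ℝ → T3 → V3), IsHardSphereEulerSolution σ T ρ u θ → ∀ Φ : (N : ℕ) → HardSphereFlow (Torus.geometry (Fin 3)) (hsDiameter σ N) (N + 1), TendstoHydroFieldsAt (fun N => localGibbsLaw σ a₀ u₀ θ₀ N (Φ N)) Φ ρ u θ 0 → ∀ T' : ℝ, T' < T →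 ∀ (χ : T3 → ℝ) (K : NNReal), LipschitzWith K χ → let kick : (N : ℕ) → ℝ → Config (N + 1) (Fin 3) T3 → Config (N + 1) (Fin 3) T3 := fun N α z => let w : V3 := (Torus.geometry (Fin 3)).sepVec (z 1).1 (z 0).1; let g : V3 := (z 1).2 - (z 0).2; let c : V3 := (2 : ℝ)⁻¹ • ((z 0).2 + (z 1).2); let e : V3 := w - (⟪w, g⟫_ℝ / ‖g‖ ^ 2) • g; let g' : V3 := Real.cos α • g + (Real.sin α * ‖g‖ * ‖e‖⁻¹) • e; if ‖w‖ < 2 * hsDiameter σ N ∧ e ≠ 0 then Function.update (Function.update z 0 ((z 0).1, c - (2 : ℝ)⁻¹ • g')) 1 ((z 1).1, c + (2 : ℝ)⁻¹ • g') else z; ∃ C : ℝ, ∃ N₀ : ℕ, ∀ N : ℕ, N₀ ≤ N → ∀ α : ℝ, |α| ≤ 1 → ∀ t ∈ Icc 0 T', |(∫ z, empiricalDensityField ((Φ N).flow t (kick N α z)) χ ∂(localGibbsLaw σ a₀ u₀ θ₀ N (Φ N))) - ∫ z, empiricalDensityField ((Φ N).flow t z) χ ∂(localGibbsLaw σ a₀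 u₀ θ₀ N (Φ N))| ≤ C * |α| * ((N + 1 : ℕ) : ℝ) ^ (-(7 / 3 : ℝ)) ∧ ‖(∫ z, empiricalMomentumField ((Φ N).flow t (kick N α z)) χ ∂(localGibbsLaw σ a₀ u₀ θ₀ N (Φ N))) - ∫ z, empiricalMomentumField ((Φ N).flow t z) χ ∂(localGibbsLaw σ a₀ u₀ θ₀ N (Φ N))‖ ≤ C * |α| * ((N + 1 : ℕ) : ℝ) ^ (-(7 / 3 : ℝ)) ∧ |(∫ z, empiricalEnergyField ((Φ N).flow t (kick N α z)) χ ∂(localGibbsLaw σ a₀ u₀ θ₀ N (Φ N))) - ∫ z, empiricalEnergyField ((Φ N).flow t z) χ ∂(localGibbsLaw σ a₀ u₀ θ₀ N (Φ N))| ≤ C * |α| * ((N + 1 : ℕ) : ℝ) ^ (-(7 / 3 : ℝ))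

-- earlier LoadedEulerRung (stmt-AtomisticToContinuum-9339, replaced 2026-08-16T23:15:50Z -> stmt-AtomisticToContinuum-17326): retired by None — open Literature.MathematicalPhysics.KineticTheory Literature.Analysis.FluidPDE in ∀ (ξ ι : ℝ), 0 < ξ → ξ < 2⁻¹ → 0 < ι → ∀ (a₀ θ₀ : T3 → ℝ) (u₀ : T3 → V3), Continuous a₀ → Continuous θ₀ → Continuous u₀ → (∀ x, 0 < a₀ x) → (∀ x, 0 < θ₀ x) → ∃ σ₀ : ℝ, 0 < σ₀ ∧
/-- item stmt-AtomisticToContinuum-17326 · crux · rank 4 · open · by planner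
why it might fail: Needs N-uniform coercivity of the phase-averaged kernel's Dirichlet form per collision with UNBOUNDED velocities and spins (Kac/Villani/Carlen–Carvalho constants) plus cubic energy-current tails along the loaded flow (HighMomentumCutoffBarrierNarrow); at fixed φ the defect η>0 caps accuracy.
sources: OllaVaradhanYau1993, Yau1991, LiveraniOlla1996, FritzFunakiLebowitz1994, Rezakhanlou2003, CarlenCarvalhoGabetta2000
[crux] THE LOADED RUNG X_R (card rungs (A)/(B); PACKING-GUARDED since the conjunct's re-type D-0032
/ p126922 — 'the conjunct's format' at each fixed load now carries the conjunct's guard verbatim):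
for every ξ ∈ (0,1/2), ι > 0 there is a packing threshold η₀ = η₀(ξ, ι) > 0 such that for all
continuous profiles a₀, θ₀ > 0, u₀ there is σ₀ > 0 such that for 0 < σ < σ₀, every classical
solution (ρ,u,θ) on [0,T) of the LOADED Euler system IsLoadedEulerSolution σ T ρ u θ (definition
request D2: IsHardSphereEulerSolution with totalEnergyDensity replaced by ρ(‖u‖²/2 + 5θ/2) — two
active rotational degrees of freedom, L·a being conserved per particle; p = hsPressure σ ρ θ
unchanged) whose local packing fraction stays below η₀ (∀ t ∈ [0,T) ∀ x, ρ_t(x)σ³ < η₀: the loaded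
gas has exactly the hard-sphere statics — LoadedStatics — hence the same dilute-fluid band of the
virial EOS, where the local Gibbs reference of step (ii) exists), and every family of loaded flows
Ψ_N : LoadedSphereFlow (Torus.geometry (Fin 3)) (hsDiameter σ N) ξ ι (N+1) (D1): if under
loadedLocalGibbsLaw σ ξ ι a₀ u₀ θ₀ N the empirical density / momentum / translational-kinetic-energy
fields of the geometric centres (the lib -/
@[route_item "route-AtomisticToContinuum-JeansLoadedDice"]
def LoadedEulerRung : Prop :=
  open Literature.MathematicalPhysics.KineticTheory Literature.Analysis.FluidPDE in ∀ (ξ ι : ℝ), 0 < ξ → ξ < 2⁻¹ → 0 < ι → ∃ η₀ : ℝ, 0 < η₀ ∧ ∀ (a₀ θ₀ : T3 → ℝ) (u₀ : T3 → V3), Continuous a₀ → Continuous θ₀ → Continuous u₀ → (∀ x, 0 < a₀ x) → (∀ x, 0 < θ₀ x) → ∃ σ₀ : ℝ, 0 < σ₀ ∧ ∀ σ : ℝ, 0 < σ → σ < σ₀ → ∀ (T : ℝ) (ρ θ : ℝ → T3 → ℝ) (u : ℝ → T3 → V3), IsLoadedEulerSolution σ T ρ u θ → (∀ t ∈ Ico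 0 T, ∀ x, ρ t x * σ ^ 3 < η₀) → ∀ Ψ : (N : ℕ) → LoadedSphereFlow (Torus.geometry (Fin 3)) (hsDiameter σ N) ξ ι (N + 1), let Tend : ℝ → Prop := fun t => ∀ χ : T3 → ℝ, Continuous χ → ∀ δ > (0 : ℝ), Tendsto (fun N => loadedLocalGibbsLaw σ ξ ι a₀ u₀ θ₀ N (Ψ N) {z | δ < |empiricalDensityField ((Ψ N).configFlow t z) χ - ∫ x, χ x * ρ t x|}) atTop (𝓝 0) ∧ Tendsto (fun N => loadedLocalGibbsLaw σ ξ ι a₀ u₀ θ₀ N (Ψ N) {z | δ < ‖empiricalMomentumField ((Ψ N).configFlow t z) χ - ∫ x, (χ x * ρ t x) • u t x‖}) atTop (𝓝 0) ∧ Tendsto (fun N => loadedLocalGibbsLaw σ ξ ι a₀ u₀ θ₀ N (Ψ N) {z | δ < |empiricalEnergyField ((Ψ N).configFlow t z) χ - ∫ x, χ x * totalEnergyDensity (ρ t x) (u t x) (θ t x)|}) atTop (𝓝 0); Tend 0 → ∀ t ∈ Ico 0 T, Tend t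

-- earlier SlackRung (stmt-AtomisticToContinuum-14681, replaced 2026-08-16T23:15:21Z -> stmt-AtomisticToContinuum-17314): retired by None — open Literature.MathematicalPhysics.KineticTheory Literature.Analysis.FluidPDE in ∀ ι : ℝ, 0 < ι → ∀ (a₀ θ₀ : T3 → ℝ) (u₀ : T3 → V3), Continuous a₀ → Continuous θ₀ → Continuous u₀ → (∀ x, 0 < a₀ x) → (∀ x, 0 < θ₀ x) → ∃ σ₀ : ℝ, 0 < σ₀ ∧ ∀ σ : ℝ, 0 < σ → σ < σ₀ → 
/-- item stmt-AtomisticToContinuum-17314 · crux · rank 5 · open · by planner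
why it might fail: Conjunct-hard: along ξ_N=κ(N+1)^(-1/6) the dice defect φ/ξ_N→∞, so the loaded gas's Euler limit needs the same one-block/ring-sector input as the true gas; and the O(κ²) translation–rotation drain (rate R(Θ)·Enskog, slow rotors R→0, long-time tails) must stay perturbative uniformly in N.
sources: OllaVaradhanYau1993, Spohn1991, doi:10.1063/1.1733511, ChapmanCowling1970, doi:10.1063/1.1731795, doi:10.1103/physreva.1.18
[crux] THE SLACK RUNG — vanishing-load rung to the CONJUNCT's Euler solution (repaired
TwoTemperatureRung: stmt-AtomisticToContinuum-14496 was refuted-misstated by refuter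
rattack-14496-0, 2026-08-16T04:37Z — it pinned the macroscopic target to the two-temperature system
with the EXACT Enskog rate c := loadedExchangeRate σ ι and claimed exact convergence at fixed σ, but
the kernel-checked torque identity ΔL = ξε·a×ΔV (Evidence14496.lean: Λ = L − ξε a×V, the angular
momentum about the geometric centre, is conserved at impacts) makes the exchange rate along ξ_N the
collisional force spectrum at the precession frequency, true/Enskog = R(Θ) ≈ 9Θ²/(4+9Θ²) < 1 with Θ
= ωτ_free ≈ 0.23/(φ√ι) N-independent at fixed σ, and not closed in (ρ, θtr, θrot);
loadedExchangeRate is only the σ → 0 asymptotic; this is the refuter's recommended C′ = SlackRung of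
Repair14496.lean). CLAIM (PACKING-GUARDED since the conjunct's re-type D-0032 / p126922,
2026-08-16T21:32Z; the guard clause is verbatim the conjunct's): for every ι > 0 there is a packing
threshold η₀ = η₀(ι) > 0 such that for all continuous profiles a₀, θ₀ > 0, u₀ there is σ₀ = σ₀(ι,
profiles) > 0 such that for 0 < σ < σ₀, every T, every clas -/
@[route_item "route-AtomisticToContinuum-JeansLoadedDice"]
def SlackRung : Prop :=
  open Literature.MathematicalPhysics.KineticTheory Literature.Analysis.FluidPDE in ∀ ι : ℝ, 0 < ι → ∃ η₀ : ℝ, 0 < η₀ ∧ ∀ (a₀ θ₀ : T3 → ℝ) (u₀ : T3 → V3), Continuous a₀ → Continuous θ₀ → Continuous u₀ → (∀ x, 0 < a₀ x) → (∀ x, 0 < θ₀ x) → ∃ σ₀ : ℝ, 0 < σ₀ ∧ ∀ σ : ℝ, 0 < σ → σ < σ₀ → ∀ (T : ℝ) (ρ θ : ℝ → T3 → ℝ) (u : ℝ → T3 → V3), IsHardSphereEulerSolution σ T ρ u θ → (∀ t ∈ Ico 0 T, ∀ x, ρ t x * σ ^ 3 < η₀) → ∀ t ∈ Ico 0 T,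 ∀ χ : T3 → ℝ, Continuous χ → ∀ δ > (0 : ℝ), ∃ κ₀ : ℝ, 0 < κ₀ ∧ ∀ κ : ℝ, 0 < κ → κ < κ₀ → ∀ Ψ : (N : ℕ) → LoadedSphereFlow (Torus.geometry (Fin 3)) (hsDiameter σ N) (loadedEccentricity κ N) ι (N + 1), let P : (N : ℕ) → Measure (LoadedConfig (N + 1) T3) := fun N => loadedLocalGibbsLaw σ (loadedEccentricity κ N) ι a₀ u₀ θ₀ N (Ψ N); let Tend : ℝ → (T3 → ℝ) → ℝ → Prop := fun s χ' δ' => Tendsto (fun N => P N {z | δ' < |empiricalDensityField ((Ψ N).configFlow s z) χ' - ∫ x, χ' x * ρ s x|}) atTop (𝓝 0) ∧ Tendsto (fun N => P N {z | δ' < ‖empiricalMomentumField ((Ψ N).configFlow s z) χ' - ∫ x, (χ' x * ρ s x) • u s x‖}) atTop (𝓝 0) ∧ Tendsto (fun N => P N {z | δ' < |empiricalEnergyField ((Ψ N).configFlow s z) χ' - ∫ x, χ' x * totalEnergyDensity (ρ s x) (u s x) (θ s x)|}) atTop (𝓝 0); (∀ χ' : T3 → ℝ, Continuous χ' → ∀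 δ' > (0 : ℝ), Tend 0 χ' δ') → Tend t χ δ

/-- item stmt-AtomisticToContinuum-16939 · crux · rank 6 · open · by operator
why it might fail: Off equilibrium nothing bounds the contact pair correlation at positive density: transient dense clusters (rattlers) or ring re-collisions could make the one-marked-particle collision intensity history-dependent and exceed C × Enskog at times O(1); only rung 0/½ (statics) are certified.
sources: GST2013, Spohn1991, BodineauGallagherSaintRaymondSimonella2023, Alexander1975
[crux] REPAIRED ContactIntensityDomination (stmt-AtomisticToContinuum-9218 was refuted-MISSTATED by
Theorems.not_SpeedCapSurgery_ContactIntensityDomination / not_ContactIntensityDomination,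
2026-08-17T00:29Z, EnergyCurrentTails line lead seat c4: with C uniform over ALL continuous
two-particle marks φ and the product of two INDEPENDENT copies of the law — spatially averaged
one-particle marginals — on the right, the hot-spot witness a₀ ≡ 1, u₀ ≡ 0, θ₀ x = 2 − ‖x‖, φ_V =
bump(v − Ve₁)bump(w + Ve₁) + swap, window (0,h], h → 0, V → ∞ gives LHS ∝ ∫G_V(θ₀)² against RHS ∝
(∫G_V(θ₀))²: a mixture of products is not dominated by the product of the mixtures in the JOINT tail
of TWO rare participants). THE ONE-RARE-PARTICIPANT CONTACT-INTENSITY CEILING — the refuter's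
repaired statement C′, variant (γ) of
Cruxes/EnergyCurrentTails/Lines/level_census_comparison_local_ceiling.lean, VERBATIM (Iff.rfl):
conjunct's frame (continuous positive profiles; σ < σ₀; T > 0; any hard-sphere flow family; local
Gibbs data); ∃ C < ⊤ ∃ N₀ ∀ N ≥ N₀ ∀ 0 ≤ s ≤ t ≤ T ∀ k ≤ 3 ∀ continuous ψ : V3 → ℝ≥0∞: the expected
collision sum over (s,t] of the marks ψ(vᵢ⁻)(1 + ‖vⱼ⁻‖)^k of the two pre-collisional velocities is ≤ -/
@[route_item "route-AtomisticToContinuum-JeansLoadedDice", crux]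
def ContactIntensityDominationOneRare : Prop :=
  open Literature.MathematicalPhysics.KineticTheory Literature.Analysis.FluidPDE in ∀ (a₀ θ₀ : T3 → ℝ) (u₀ : T3 → V3), Continuous a₀ → Continuous θ₀ → Continuous u₀ → (∀ x, 0 < a₀ x) → (∀ x, 0 < θ₀ x) → ∃ σ₀ : ℝ, 0 < σ₀ ∧ ∀ σ : ℝ, 0 < σ → σ < σ₀ → ∀ T : ℝ, 0 < T → ∀ Φ : ((N : ℕ) → HardSphereFlow (Torus.geometry (Fin 3)) (hsDiameter σ N) (N + 1)), ∃ C : ENNReal, C < ⊤ ∧ ∃ N₀ : ℕ, ∀ N : ℕ, N₀ ≤ N → ∀ s t : ℝ, 0 ≤ s → s ≤ t → t ≤ T → ∀ k : ℕ, k ≤ 3 → ∀ ψ : V3 → ENNReal, Continuous ψ → (∫⁻ z, (∑ᶠ τ ∈ collisionTimes (Torus.geometry (Fin 3)) (hsDiameter σ N) (fun r => (Φ N).flow r z) ∩ Set.Ioc s t, ∑ i : Fin (N + 1), ∑ j : Fin (N + 1), if i = j then (0 : ENNReal) else (contactSet (Torus.geometry (Fin 3)) (N + 1) (hsDiameter σ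 N) i j).indicator (fun y => (fun p : V3 × V3 => ψ p.1 * ENNReal.ofReal ((1 + ‖p.2‖) ^ k)) ((((collidePair (Torus.geometry (Fin 3)) i j y)) i).2, (((collidePair (Torus.geometry (Fin 3)) i j y)) j).2)) ((Φ N).flow τ z)) ∂(localGibbsLaw σ a₀ u₀ θ₀ N (Φ N))) ≤ C * ENNReal.ofReal ((σ ^ 2 * ((N + 1 : ℕ) : ℝ) ^ ((1 : ℝ) / 3)) / ((N + 1 : ℕ) : ℝ)) * ∫⁻ τ in Set.Ioc s t, (∫⁻ z, ∫⁻ z', (∑ i : Fin (N + 1), ∑ j : Fin (N + 1), ψ ((((Φ N).flow τ z) i).2) * ENNReal.ofReal ((1 + ‖(((Φ N).flow τ z') j).2‖) ^ k) * ENNReal.ofReal ‖(((Φ N).flow τ z) i).2 - (((Φ N).flow τ z') j).2‖) ∂(localGibbsLaw σ a₀ u₀ θ₀ N (Φ N)) ∂(localGibbsLaw σ a₀ u₀ θ₀ N (Φ N)))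

-- earlier LoadedTransfer (stmt-AtomisticToContinuum-9222, replaced 2026-08-17T00:49:53Z -> stmt-AtomisticToContinuum-16943): retired by None — OneKickFootprint → ContactIntensityDomination → _root_.HydrodynamicLimit
/-- item stmt-AtomisticToContinuum-16943 · crux · rank 9 · open · by operator
why it might fail: Conjunct-equivalent modulo 9217/9218 (HydrodynamicLimit -> LoadedTransfer by fun _ _ => h): its only intended proof is TwoTemperatureRung along xi_N = kappa(N+1)^(-1/6) -> 0, where the dice defect phi/xi_N -> infinity, plus an untyped Lindeberg swap needing a xi-UNIFORM footprint.
sources: OllaVaradhanYau1993, ChenLevermoreLiu1994, doi:10.1006/jdeq.1998.3584, Spohn1991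
[support] THE CONSUMER (typed shadow of the card's leg (C); restated 2026-08-17 over the REPAIRED
contact budget after ContactIntensityDomination stmt-9218 was refuted-misstated — the previous text,
with the refuted conjunct as second hypothesis, had become vacuously true): OneKickFootprint →
ContactIntensityDominationOneRare → HydrodynamicLimit (the sub-problem Statement decl). Intended
proof = the loaded programme: for κ < κ₀(t, χ, δ/2), SlackRung puts the χ-tested translational
fields of LS(σ, κ(N+1)^(-1/6), ι) at time t within δ/2 of the conjunct's Euler solution with
probability → 1, and a Lindeberg/Duhamel swap in ξ ∈ [0, κ(N+1)^(-1/6)] at the same N — the frame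
item Assembly — (d/dξ E_ξ[F(fields_t)] = Σ_contacts E[(∂_ξ outcome)·(footprint)], footprint bound
assumed UNIFORM along the loaded family, contact budget Σ_contacts ξ_N|g|, Σ ξ_N²|g|² from
ContactIntensityDominationOneRare with the one-rare/bulk marks ψ = 1+‖·‖, k = 1 and ψ = (1+‖·‖)², k
= 2, by monotonicity of the collision functional in the mark) puts the true gas's field laws within
O(κ(N+1)^(-1/6)) + O(κ²) of the loaded ones; N → ∞, then κ → 0. In substance as hard as the conjunct
(contains SlackRung: LoadedTransf -/
@[route_item "route-AtomisticToContinuum-JeansLoadedDice", crux]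
def LoadedTransfer : Prop :=
  OneKickFootprint → ContactIntensityDominationOneRare → _root_.HydrodynamicLimit

/-- item stmt-AtomisticToContinuum-14686 · support · rank 9 · open · by planner
[support] LOADED-FLOW EXISTENCE at the conjunct's scaling (Alexander's scheme for Jeans' loaded
spheres; makes the ∀Ψ of PhaseFreshness / LoadedEulerRung / SlackRung / LoadedStatics non-vacuous —
D1's docstring (LoadedSphereDynamics.lean, Design choices) records that EXISTENCE is a statement of
the route, not a field, and it had not been filed): for 0 < σ < 1/2, 0 ≤ ξ < 1/2, ι > 0 and every N
there is a LoadedSphereFlow (Torus.geometry (Fin 3)) (hsDiameter σ N) ξ ι (N+1) — a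
loadedLiouville-conull invariant measurable good set inside the loaded domain carrying a measurable
measure-preserving one-parameter group of loaded-sphere trajectories (free flight = straight
mass-centre motion + uniform rotation of the load about L, so the geometric centre wobbles on a
circle of radius ξε_N; binary incoming contacts of geometric centres at distance ε_N = hsDiameter σ
N ≤ σ < 1/2 resolved by loadedImpact). INTENDED PROOF: adapt the tree's PROVED ξ = 0 case
HardSphereFlow.nonempty_torus_holds (Literature.Analysis.FluidPDE.HardSphereAlexander: Alexander
1975 / GST2013 Prop. 4.1.1 on 𝕋^d) — the pathological set (grazing, triple or infinitely many
contacts in finite time) is loadedLiouville-null b -/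
@[route_item "route-AtomisticToContinuum-JeansLoadedDice"]
def LoadedFlowExistence : Prop :=
  open Literature.MathematicalPhysics.KineticTheory Literature.Analysis.FluidPDE in ∀ (σ ξ ι : ℝ), 0 < σ → σ < 2⁻¹ → 0 ≤ ξ → ξ < 2⁻¹ → 0 < ι → ∀ N : ℕ, Nonempty (LoadedSphereFlow (Torus.geometry (Fin 3)) (hsDiameter σ N) ξ ι (N + 1))

/-- item stmt-AtomisticToContinuum-9219 · support · rank 9 · open · by planner
sources: Spohn1991, BodineauGallagherSaintRaymondSimonella2023, doi:10.4007/annals.2023.198.3.3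
[support] GLOBAL-EQUILIBRIUM special case of OneKickFootprint (profiles a₀ ≡ 1, u₀ ≡ 0, θ₀ ≡ θe; any
horizon T; same kick, fields and bound C|α|(N+1)^(-7/3)): a Green–Kubo-type statement — mean field
response at time t to a conserved dipole planted at time 0 under the invariant Gibbs law — the
cheapest place to prove or refute the footprint. [deps: OneKickFootprint] [difficulty: XL] -/
@[route_item "route-AtomisticToContinuum-JeansLoadedDice"]
def EquilibriumKickResponse : Prop :=
  open Literature.MathematicalPhysics.KineticTheory Literature.Analysis.FluidPDE in ∀ θe : ℝ, 0 < θe → ∃ σ₀ : ℝ, 0 < σ₀ ∧ ∀ σ : ℝ, 0 < σ → σ < σ₀ → ∀ T : ℝ, 0 < T → ∀ Φ : (N : ℕ) → HardSphereFlow (Torus.geometry (Fin 3)) (hsDiameter σ N) (N + 1), ∀ (χ : T3 → ℝ) (K : NNReal), LipschitzWith K χ → let kick : (N : ℕ) → ℝ → Config (N + 1) (Fin 3) T3 → Config (N + 1) (Fin 3) T3 := fun N α z => let w : V3 := (Torus.geometry (Fin 3)).sepVec (z 1).1 (z 0).1; let g : V3 := (z 1).2 - (z 0).2; let c : V3 :=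 (2 : ℝ)⁻¹ • ((z 0).2 + (z 1).2); let e : V3 := w - (⟪w, g⟫_ℝ / ‖g‖ ^ 2) • g; let g' : V3 := Real.cos α • g + (Real.sin α * ‖g‖ * ‖e‖⁻¹) • e; if ‖w‖ < 2 * hsDiameter σ N ∧ e ≠ 0 then Function.update (Function.update z 0 ((z 0).1, c - (2 : ℝ)⁻¹ • g')) 1 ((z 1).1, c + (2 : ℝ)⁻¹ • g') else z; ∃ C : ℝ, ∃ N₀ : ℕ, ∀ N : ℕ, N₀ ≤ N → ∀ α : ℝ, |α| ≤ 1 → ∀ t ∈ Icc 0 T, |(∫ z, empiricalDensityField ((Φ N).flow t (kick N α z)) χ ∂(localGibbsLaw σ (fun _ => 1) (fun _ => 0) (fun _ => θe) N (Φ N))) - ∫ z, empiricalDensityField ((Φ N).flow t z) χ ∂(localGibbsLaw σ (fun _ => 1) (fun _ => 0) (fun _ => θe) N (Φ N))| ≤ C * |α| * ((N + 1 : ℕ) : ℝ) ^ (-(7 / 3 : ℝ)) ∧ ‖(∫ z, empiricalMomentumField ((Φ N).flow t (kick N α z)) χ ∂(localGibbsLaw σ (fun _ => 1) (fun _ =>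 0) (fun _ => θe) N (Φ N))) - ∫ z, empiricalMomentumField ((Φ N).flow t z) χ ∂(localGibbsLaw σ (fun _ => 1) (fun _ => 0) (fun _ => θe) N (Φ N))‖ ≤ C * |α| * ((N + 1 : ℕ) : ℝ) ^ (-(7 / 3 : ℝ)) ∧ |(∫ z, empiricalEnergyField ((Φ N).flow t (kick N α z)) χ ∂(localGibbsLaw σ (fun _ => 1) (fun _ => 0) (fun _ => θe) N (Φ N))) - ∫ z, empiricalEnergyField ((Φ N).flow t z) χ ∂(localGibbsLaw σ (fun _ => 1) (fun _ => 0) (fun _ => θe) N (Φ N))| ≤ C * |α| * ((N + 1 : ℕ) : ℝ) ^ (-(7 / 3 : ℝ))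

/-- item stmt-AtomisticToContinuum-9220 · support · rank 9 · open · by planner
sources: Arnold1989, Kifer2009
[support] FEJÉR WRAPPING (card E3a, provable now): if a real random variable τ has a probability
density f with L¹-modulus ∫|f(x+h) − f(x)|dx ≤ L|h|, then for every frequency Ω > 0 and phase θ₀ the
law of θ₀ + Ωτ mod 1 is within L/(4Ω) of Haar on the circle, set by set: |P(θ₀ + Ωτ ∈ A) − |A|| ≤
L/(4Ω) for every measurable A ⊂ ℝ/ℤ (average the wrapped density over one period). With f =
s⁻¹F(·/s) this is the card's C/(Ωs). [difficulty: provable-now] -/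
@[route_item "route-AtomisticToContinuum-JeansLoadedDice"]
def FejerWrapping : Prop :=
  ∀ (f : ℝ → ℝ), (∀ x, 0 ≤ f x) → Integrable f → ∫ x, f x = 1 → ∀ L : ℝ, 0 ≤ L → (∀ h : ℝ, ∫ x, |f (x + h) - f x| ≤ L * |h|) → ∀ Ω : ℝ, 0 < Ω → ∀ θ₀ : ℝ, ∀ A : Set UnitAddCircle, MeasurableSet A → |(∫ x in {x : ℝ | ((θ₀ + Ω * x : ℝ) : UnitAddCircle) ∈ A}, f x) - (volume A).toReal| ≤ L / (4 * Ω)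

/-- item stmt-AtomisticToContinuum-9221 · support · rank 9 · open · by planner
sources: doi:10.1063/1.1733511, ChapmanCowling1970, CoxFeres2016
[support] FAIR-DICE MECHANICS (card S1, provable now; fixes the collision law of D1): for diameter ε
> 0, eccentricity ξ ≥ 0, isotropic inertia ιε², unit masses, unit vectors a_i, a_j (mass centre →
geometric centre) and contact normal n (i → j), the two-body impact map Λ on (V_i,V_j,L_i,L_j) — g_n
= ⟨n,V_i − V_j⟩ + ξε(⟨n,ω_i×a_i⟩ − ⟨n,ω_j×a_j⟩), ω = L/(ιε²); J = 2g_n/(2 + (ξ²/ι)((1 − ⟨a_i,n⟩²) +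
(1 − ⟨a_j,n⟩²))); V_i ↦ V_i − Jn, V_j ↦ V_j + Jn, L_i ↦ L_i − Jξε(a_i×n), L_j ↦ L_j + Jξε(a_j×n) —
conserves V_i + V_j and |V_i|²/2 + |V_j|²/2 + (|L_i|² + |L_j|²)/(2ιε²), reverses g_n, and is an
involution (being linear, it then preserves Lebesgue measure: Liouville⊗Gaussian invariance and
detailed balance of K̄_ξ follow by Haar-averaging). [difficulty: provable-now] -/
@[route_item "route-AtomisticToContinuum-JeansLoadedDice"]
def LoadedImpactInvolution : Prop :=
  open Literature.MathematicalPhysics.KineticTheory in let cr : V3 → V3 → V3 := fun x y => WithLp.toLp 2 (crossProduct (WithLp.ofLp x) (WithLp.ofLp y)); ∀ (ε ξ ι : ℝ), 0 < ε → 0 ≤ ξ → 0 < ι → ∀ (ai aj n : V3), ‖ai‖ = 1 → ‖aj‖ = 1 → ‖n‖ = 1 → let gn : V3 × V3 × V3 × V3 → ℝ := fun p => ⟪n, p.1 - p.2.1⟫_ℝ + ξ * ε * (⟪n, cr ((ι * ε ^ 2)⁻¹ • p.2.2.1) ai⟫_ℝ - ⟪n, cr ((ι * ε ^ 2)⁻¹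 • p.2.2.2) aj⟫_ℝ); let J : V3 × V3 × V3 × V3 → ℝ := fun p => 2 * gn p / (2 + ξ ^ 2 / ι * ((1 - ⟪ai, n⟫_ℝ ^ 2) + (1 - ⟪aj, n⟫_ℝ ^ 2))); let Λ : V3 × V3 × V3 × V3 → V3 × V3 × V3 × V3 := fun p => (p.1 - J p • n, p.2.1 + J p • n, p.2.2.1 - (J p * ξ * ε) • cr ai n, p.2.2.2 + (J p * ξ * ε) • cr aj n); ∀ p : V3 × V3 × V3 × V3, (Λ p).1 + (Λ p).2.1 = p.1 + p.2.1 ∧ ‖(Λ p).1‖ ^ 2 / 2 + ‖(Λ p).2.1‖ ^ 2 / 2 + (‖(Λ p).2.2.1‖ ^ 2 + ‖(Λ p).2.2.2‖ ^ 2) / (2 * (ι * ε ^ 2)) = ‖p.1‖ ^ 2 / 2 + ‖p.2.1‖ ^ 2 / 2 + (‖p.2.2.1‖ ^ 2 + ‖p.2.2.2‖ ^ 2) / (2 * (ι * ε ^ 2)) ∧ gn (Λ p) = -gn p ∧ Λ (Λ p) = p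

/-- item stmt-AtomisticToContinuum-9351 · support · rank 9 · open · by planner
[support] LOADED STATICS = HARD-SPHERE STATICS (card E1/S3; provable once D1 lands): under
loadedLocalGibbsLaw σ ξ ι a₀ u₀ θ₀ N (density ∝ 𝟙_domain ∏ a₀(X_k)
M_(1,u₀(X_k),θ₀(X_k))(V_k)·Gaussian(L_k; ιε²θ₀(X_k)) ⊗ Haar(a_k), activity evaluated at the
GEOMETRIC centre X_k) the law of k ↦ (X_k, V_k) is EXACTLY localGibbsLaw σ a₀ u₀ θ₀ N (the hard-core
constraint is on geometric centres; (X,a) ↦ (X − ξεa, a) is a shear preserving volume ⊗ area, so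
mass-centre and geometric-centre parametrisations carry the same product measure), the a_k are
independent Haar and the L_k independent Gaussians given positions; consequently hsFreeVolume,
hsExcessFreeEnergy, hsPressure, the law of large numbers localGibbs_lln and every static
large-deviation / cluster-expansion input of the entropy routes transfer VERBATIM to LS(σ,ξ,ι); and
every constant-profile hs-Gibbs ⊗ Haar ⊗ Gaussian state is invariant under every loaded flow
(loadedLiouville preserved + momentum and total energy conserved, LoadedImpactInvolution). SOURCES:
Spohn1991 Part I Ch. 3, Ruelle1969 §3.4, doi:10.1063/1.1733511. [difficulty: provable-now after D1] -/
@[route_item "route-AtomisticToContinuum-JeansLoadedDice"]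
def LoadedStatics : Prop :=
  open Literature.MathematicalPhysics.KineticTheory Literature.Analysis.FluidPDE in ∀ (σ ξ ι : ℝ), 0 < σ → 0 ≤ ξ → ξ < 2⁻¹ → 0 < ι → ∀ (a₀ θ₀ : T3 → ℝ) (u₀ : T3 → V3), Continuous a₀ → Continuous θ₀ → Continuous u₀ → (∀ x, 0 < a₀ x) → (∀ x, 0 < θ₀ x) → ∀ (N : ℕ) (Ψ : LoadedSphereFlow (Torus.geometry (Fin 3)) (hsDiameter σ N) ξ ι (N + 1)) (Φ : HardSphereFlow (Torus.geometry (Fin 3)) (hsDiameter σ N) (N + 1)), (loadedLocalGibbsLaw σ ξ ι a₀ u₀ θ₀ N Ψ).map loadedProjection = localGibbsLaw σ a₀ u₀ θ₀ N Φ ∧ ((∃ ca cθ : ℝ, ∃ cu : V3, a₀ = (fun _ => ca) ∧ θ₀ = (fun _ => cθ) ∧ u₀ = (fun _ => cu)) → ∀ t : ℝ, (loadedLocalGibbsLaw σ ξ ι a₀ u₀ θ₀ N Ψ).map (Ψ.flow t) = loadedLocalGibbsLaw σ ξ ι a₀ u₀ θ₀ N Ψ)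

-- earlier Assembly (stmt-AtomisticToContinuum-14574, replaced 2026-08-16T05:48:08Z -> stmt-AtomisticToContinuum-14682): retired by None — OneKickFootprint → TwoTemperatureRung → ContactIntensityDomination → _root_.HydrodynamicLimit
-- earlier Assembly (stmt-AtomisticToContinuum-14682, replaced 2026-08-17T00:49:15Z -> stmt-AtomisticToContinuum-16942): retired by None — OneKickFootprint → SlackRung → ContactIntensityDomination → _root_.HydrodynamicLimit
-- earlier Assembly (stmt-AtomisticToContinuum-9223, replaced 2026-08-16T03:57:44Z -> stmt-AtomisticToContinuum-14574): retired by None — OneKickFootprint → ContactIntensityDomination → LoadedTransfer → _root_.HydrodynamicLimit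
/-- item stmt-AtomisticToContinuum-16942 · assembly · rank 1 · open · by operator
sources: OllaVaradhanYau1993, Spohn1991
[assembly] X_T → HydrodynamicLimit BY NAME (frame statement #1; restated 2026-08-17 over the
REPAIRED contact budget after ContactIntensityDomination stmt-9218 was refuted-misstated — its
previous text, with the refuted conjunct as third hypothesis, had become vacuously true):
OneKickFootprint → SlackRung → ContactIntensityDominationOneRare → HydrodynamicLimit — THE LINDEBERG
SWAP on its own: at fixed σ < σ₀, profiles, hs-Euler solution inside the packing guard, t ∈ [0,T),
continuous χ and δ > 0, P_true(χ-tested field at t off by δ) ≤ P_LS(κ)(off by δ/2) + (swap error),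
where the swap in ξ ∈ [0, ξ_N] at the same N (d/dξ E_ξ[F(fields_t)] = Σ_contacts E[(∂_ξ
outcome)·(footprint)], F a δ⁻¹-Lipschitz cutoff; footprint from OneKickFootprint, assumed uniform
along the loaded family; contact budget Σ_contacts ξ_N|g| ≍ ξ_N(N+1)^(4/3) from
ContactIntensityDominationOneRare with the one-rare/bulk marks ψ = 1+‖·‖, k = 1 (|g| ≤ ‖v−w‖ ≤
(1+‖v‖)(1+‖w‖)) and k = 2 for the second-order term) is O(ξ_N) = O(κ(N+1)^(-1/6)) at first order and
O(ξ_N²(N+1)^(1/3)) = O(κ²) at second order; N → ∞ (SlackRung supplies κ₀(t, χ, δ/2) and kills the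
first term), then κ → 0. Logically Assembly ↔ (SlackRung → Load -/
@[route_item "route-AtomisticToContinuum-JeansLoadedDice"]
def Assembly : Prop :=
  OneKickFootprint → SlackRung → ContactIntensityDominationOneRare → _root_.HydrodynamicLimit

-- records of items no longer active in this route (dropped / restated):
-- earlier TwoTemperatureRung (stmt-AtomisticToContinuum-14496, replaced 2026-08-16T05:48:08Z -> stmt-AtomisticToContinuum-14681): retired by None — open Literature.MathematicalPhysics.KineticTheory Literature.Analysis.FluidPDE in ∀ (κ ι : ℝ), 0 < κ → κ < 2⁻¹ → 0 < ι → ∀ (a₀ θ₀ : T3 → ℝ) (u₀ : T3 → V3), Continuous a₀ → Continuous θ₀ → Continuous u₀ → (∀ x, 0 < a₀ x) → (∀ x, 0 < θ₀ x) → ∃ σ₀ : ℝ, 0 < 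
-- earlier ContactIntensityDomination (stmt-AtomisticToContinuum-9218, dropped 2026-08-17T00:50:44Z): refuted by Summit.AtomisticToContinuum.HydrodynamicLimit.Theorems.not_SpeedCapSurgery_ContactIntensityDomination @ 5976b5e32bfa — ∀ (a₀ θ₀ : Literature.MathematicalPhysics.KineticTheory.T3 → ℝ) (u₀ : Literature.MathematicalPhysics.KineticTheory.T3 → Literature.MathematicalPhysics.KineticTheory.V3), C
-- earlier TwoTemperatureRung (stmt-AtomisticToContinuum-9341, replaced 2026-08-16T03:28:51Z -> stmt-AtomisticToContinuum-14496): retired by None — [crux] THE TWO-TEMPERATURE RUNG (card regime (R2); what LoadedTransfer consumes): along the eccentricity sequence ξ_N = κ(N+1)^(-1/6), for every κ ∈ (0, κ₀] and UNIFORMLY in κ, the conclusion of LoadedEulerRung holds with the TWO-TEMPERATURE loaded Euler 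

/-! D-0027 §2.1 — DECIDING THEOREM (planner-authored via `route open/edit --closes-file`; by operator:999:1112572 2026-08-17T00:49:53Z):
its hypotheses are this route's items and its conclusion the sub-problem Statement (glue_lint), and it elaborates with this file. -/

@[closes "route-AtomisticToContinuum-JeansLoadedDice"] theorem closes (h₁ : OneKickFootprint) (h₂ : ContactIntensityDominationOneRare) (h₃ : LoadedTransfer) : _root_.HydrodynamicLimit := h₃ h₁ h₂

end Summit.AtomisticToContinuum.HydrodynamicLimit.Theses.JeansLoadedDice
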